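import Literature.Analysis.OperatorTheory.HermitianKernelSpectralTrace
import Literature.Analysis.OperatorTheory.JointEigenbasis
import Literature.Analysis.OperatorTheory.CompactPositiveTopLevel
import Literature.Analysis.OperatorTheory.PathKernelDomination
import Summits.QuantumFields.YangMills.Theorems.BalabanLadderIRcofEquipartitionSeamKernelDefs
import HarnessLib

/-!
# Crux `IRcof` (stmt-QuantumFields-26930) · line `equipartition_seam` (census row 47) · stub **D `KernelCurrency.SpectralDictV`**
# SPLIT: the spectral dictionary is DERIVED from ONE located lattice stub

`theorem spectralDictV_of_sliceRealisationV : SliceRealisationV → KernelCurrency.SpectralDictV` — **sorry-free** (§8).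

Stub D of skeleton rev 8 (`Lines/equipartition_seam.lean`, 63348d2f2d1c; text = `Theorems/…KernelDefs.lean` l.101/l.166, p687323)
asks, for every admissible split weight `w`, every box `S ≥ S_D β` and every sector base `z₀`, for ONE flux datum `(λᵢ, χᵢ)` —
nonnegative `λᵢ ≤ growthRate`, unit multiplicative characters `χᵢ` of the electric twist group `(Fin 3 → ker π)` — carrying BOTH the
weightless twisted trace formulas `Z_w(z₀|e; m) = Σᵢ χᵢ(e) λᵢ^m` (all `m ≥ 2`) AND the species insertions
`W_{w,A}(z₀|e) = Σᵢ χᵢ(e) λᵢ^{2S+1-thick A} dᵢ`, `|dᵢ| ≤ nrm A · growthRate^{thick A}`, with `thick`, `nrm` GLOBAL (chosen before `β`).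
This file proves that all of this is forced by a purely lattice-side, REAL statement — the time-slice realisation
`SliceRealisationV` (§8: a symmetric positive-type bounded kernel `K` on a probability space, a measure-preserving `K`-invariant action
`T` of the twist group, the identity `Z = ∫ (κ^{M+1}K(·,x))(T_e x)`, and for each species a real block kernel dominated pointwise by
`nrm A ·` the path kernel of `K`, with the cyclic block identity for `W`) — by an abstract argument in complex `L²`:
* §1–§2 Koopman unitaries `U_c` of the twists; `K ∘ T = K` ⇒ `𝔸 U_c = U_c 𝔸`; adjoints.
* §3 a JOINT orthonormal eigenbasis of the compact positive self-adjoint `𝔸` and the commuting finite abelian unitary group on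
  `ker 𝔸ᗮ` (finite-dimensional eigenspaces of `𝔸` are `U`-invariant; simultaneous diagonalisation there; `ker 𝔸` padded by any basis —
  its vectors carry `λᵢ = 0` and never contribute): `𝔸 bᵢ = λᵢ bᵢ`, `U_c bᵢ = χᵢ(c) bᵢ` (`λᵢ ≠ 0`), `χᵢ` unit characters.
* §4 the WEIGHTLESS twisted trace formula `Σᵢ χᵢ(c) λᵢ^{M+2} = ∫ (κ^{M+1} K(·,x))(T_c x) dμ` (Parseval on the sections `K(·,x)`,
  dominated convergence with dominant `Σᵢ λᵢ² |⟪bᵢ,k_x⟫|… ≤ C²`), all `M`; this is why the currency must be COMPLEX: D's sums have no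
  weights and `e`-independent `dᵢ`, which forces a joint eigenbasis, and joint eigenvalues of unitaries are complex.
* §5 `growthRate = ‖𝔸‖` from the untwisted traces (`limsup (Σ λᵢ^{m+1})^{1/(m+1)} = max λᵢ = ‖𝔸‖`, incl. `𝔸 = 0`).
* §6 kernel calculus: kernels of compositions and of `U_c 𝔸`; the named path kernels `pathK` of a real kernel, `𝔸^{r+1} = Op(P_r)`, and the
  block bound `|⟪φ, Bφ⟫| ≤ nrm ‖𝔸‖^{r+1} ‖φ‖²` whenever `|B_k| ≤ nrm · P_r` pointwise (via `|φ|`, positivity of `𝔸`).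
* §7 positive type (REAL bounded measurable test functions ⇒ complex ⇒) `Re ⟪φ, 𝔸φ⟫ ≥ 0` on `L²(ℂ)`; the Z-clause and the W-clause in cast form — the
  latter from the SANDWICHED trace formula `Σᵢ λᵢ^{M+4} ⟪bᵢ, (B U_e) bᵢ⟫ = ∫ k(V₀,V₁) ∏ K` (§0) with `U_e bᵢ = χᵢ(e) bᵢ`.
* §8 `def SliceRealisationV` (the located stub, with the intended witnesses in its docstring) and the assembly.
* §0 is a VERBATIM COPY (sub-namespace `SandwichCopy`) of the tree module `Literature/Analysis/OperatorTheory/HermitianKernelSandwichedTrace.lean`: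
  that module is in `Literature.lean` since 2026-08-17 but has NO olean on the Lean farm (`import` answers `remote:stale:…:unbuilt`), so no
  checked file can import it; when the farm builds it, §0 is replaced by the import (same declaration names under `open`).

REV 2 (this file; crit-3 g5 TYPEREAD CLEAN + JUNK ∕ COSTUME ∕ SHRED PASS of rev 1, bus l.1726): ONE clause of L changed — the positive-type
clause is now in the tree's REAL form `∀ φ : X → ℝ, Measurable φ → |φ| ≤ 1 → 0 ≤ ∬ φ K φ` (verbatim the conclusion shape of
`WilsonTorusTransferMatrix.integral_integral_fibreAverage_nonneg` ∕ `CentralFunctionTransferKernel.posType_kernel_zero`, the lemmas a prover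
will discharge it with); the complex form used by the spectral side is DERIVED (`complexPosType_of_real`, §7); L's docstring gained the
template pointers (`SlabTransferKernel` cyclic kernel chain, Lüscher gauge averaging).  Everything else byte-identical in content.

LANDING MAP (crit-3 conditions L1–L4, l.1726 — LEAD's lane; ≤ 400 l. per file, `--kind proof --supports 26930 --as helper`, ns kept):
(A) `…SpectralDictKoopman.lean` = §1–§3 (needs Literature `JointEigenbasis` [`JointSpectral.*`, `Orthonormal.countable_of_separableSpace`];
no other tree operator-theory lemma) · (B) `…SpectralDictTrace.lean` = §4–§5 (needs A + `HermitianKernelSpectralTrace`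
[`iterate_kernel_eq_inner_rclike`, `hasSum_inner_conj_section_pow`] + `CompactPositiveTopLevel` + `PathKernelDomination`
[`limsup_rpow_eq_of_hasSum_pow`]) · (C) `…SpectralDictKernelCalc.lean` = §6 (needs A + `HermitianKernelOperator` [`inner_eq_integral_of_ae_kernel`,
`exists_kernelOp_rclike`] + `IntegralOperatorHilbertSchmidt`) · (D1) `…SpectralDictPositive.lean` = §7 up to `hasSum_chi_pow_ofReal_iterate`
(needs B; NO §0) · (D2) `…SpectralDictBlock.lean` = `hasSum_chi_pow_inner_block` (needs B, C and §0 BY IMPORT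
`Literature.Analysis.OperatorTheory.HermitianKernelSandwichedTrace` — waits for the farm olean, L2; no text copy lands) · (E) `…SpectralDict.lean` =
§8 (needs D1, D2, C + `KernelDefs`).  A, B, C, D1 can land now; D2, E after the olean.  Skeleton rev 9 (L4) after E is ACCEPTED; crit-3 stamps.

PROPOSED skeleton rev 9 (LEAD / crit-3 to rule; stub count stays SIX, no shred): replace `stub_spectralDictV : KernelCurrency.SpectralDictV` by
`stub_sliceRealisationV : SpectralDict.SliceRealisationV` and feed `spectralDictV_of_sliceRealisationV stub_sliceRealisationV` to
`eblindUnitsV_of_peeling`; LAND-ASK: this file (minus §0 once importable) as `Theorems/BalabanLadderIRcofEquipartitionSeamSpectralDict.lean`,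
`--supports stmt-QuantumFields-26930 --as helper`.

HONEST: an abstract spectral lemma and a re-location of stub D onto the lattice slicing identities; NOTHING located is proved (S1, S3ʷ, T, N,
S5ᵛ open; D now = proved analysis ∘ open lattice stub L); `IRcof` ∕ `IR` 0 ∕ 1; row 47 PWP, mechanism 0; nothing continuum ∕ OS; the
Yang–Mills mass gap (Clay problem) is NOT proved by any of this.  (ideator ym-ir-idea-22 g7, 2026-08-29)

References: K. Osterwalder, E. Seiler, Ann. Phys. 110 (1978) 440 (transfer matrix / positivity of lattice gauge theory); E. Seiler, LNP 159
(1982) Ch. 2; B. Simon, *Trace Ideals* (2005) Ch. 3; Reed–Simon I §VI.5–6 (compact self-adjoint operators, Hilbert–Schmidt kernels);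
G. 't Hooft, Nucl. Phys. B153 (1979) 141 (twisted boundary conditions / electric flux characters). [folklore analysis]
-/

noncomputable section

open MeasureTheory Filter Function Topology
open scoped InnerProductSpace ComplexConjugate ENNReal
open Literature.Analysis.OperatorTheory


/-! ## §0  Sandwiched-insertion trace formula — VERBATIM COPY of the tree module
`Literature/Analysis/OperatorTheory/HermitianKernelSandwichedTrace.lean` (in `Literature.lean` since 2026-08-17 but
WITHOUT an olean on the Lean farm: `import` answers `remote:stale:…:unbuilt`, so no checked file can import it yet).
The declarations below are copied unchanged into the sub-namespace `SandwichCopy`; when the farm builds the module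
the LEAD replaces this section by `import Literature.Analysis.OperatorTheory.HermitianKernelSandwichedTrace` and
`open Literature.Analysis.OperatorTheory` (same names).  Credits / references as in that module:
B. Simon, *Trace Ideals* (2005), Ch. 3; Reed–Simon I §VI.6. [folklore] -/

namespace Summit.QuantumFields.YangMills.Cruxes.IRcof.EquipartitionSeam.SpectralDict.SandwichCopy

open MeasureTheory Filter Set Function
open scoped InnerProductSpace ComplexConjugate ENNReal
open Literature.Analysis.OperatorTheory


/-! ### Peeling the cycle with one heterogeneous bond -/

section Peeling

variable {Y : Type*}

/-- **Cutting the cycle `Fin (M+3)` behind the inserted bond.**  For `V = x ∷ ζ`, the `M + 2` homogeneous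
bonds `∏_{t : Fin (M+2)} K(V (t+1), V (t+2))` (indices in `Fin (M+3)`, the last bond is `K(V (M+2), V 0)`) are
the open path weight `∏_{i : Fin (M+1)} K(ζ i, ζ (i+1))` of `ζ` times the closing bond `K(ζ_{last}, x)` (any
commutative monoid of weights). [folklore] -/
theorem prod_cyclic_succ_cons {M₀ : Type*} [CommMonoid M₀] (K : Y → Y → M₀) (M : ℕ) (x : Y)
    (ζ : Fin (M + 2) → Y) :
    ∏ t : Fin (M + 2), K ((Fin.cons x ζ : Fin (M + 3) → Y) t.succ)
        ((Fin.cons x ζ : Fin (M + 3) → Y) (t.succ + 1)) =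
      (∏ i : Fin (M + 1), K (ζ (Fin.castSucc i)) (ζ i.succ)) * K (ζ (Fin.last (M + 1))) x := by
  rw [Fin.prod_univ_castSucc]
  congr 1
  · refine Finset.prod_congr rfl fun i _ => ?_
    rw [Fin.cons_succ, Fin.succ_castSucc, Fin.coeSucc_eq_succ, Fin.cons_succ]
  · rw [Fin.cons_succ, Fin.succ_last, Fin.last_add_one, Fin.cons_zero]

variable {𝕜 : Type*} [RCLike 𝕜] [MeasurableSpace Y] {ρ : Measure Y} [IsFiniteMeasure ρ]
  {kB K : Y → Y → 𝕜} {CB C : ℝ}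

/-- **Peeling the cycle with a heterogeneous first bond** (`RCLike`-valued kernels).  For bounded measurable
kernels `k_B, K` on a finite measure space `(Y, ρ)` and `κ f = ∫ K(·, z) f(z) dρ(z)`, the cyclic integral
over `Fin (M+3)` sites with `k_B` on the bond `0 → 1` and `K` on the remaining `M + 2` bonds is
`∫ k_B(V 0, V 1) ∏_{t : Fin (M+2)} K(V (t+1), V (t+2)) dρ^{⊗(M+3)}(V) = ∫∫ k_B(x, y) (κ^[M+1] K(·, x))(y) dρ(y) dρ(x)`:
the `M + 2` bonds from `y = V 1` back to `x = V 0` give the iterated kernel `K^{(M+2)}(y, x)` (Fubini along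
`Fin.cons` at sites `0` and `1`, then `integral_pathWeight_mul_kernel_last_eq_iterate_rclike`; the
`RCLike` analogue of `HeterogeneousCyclicPeeling.integral_cyclic_insert_one`). [folklore] -/
theorem integral_cyclic_bond_insert_eq_integral_iterate_rclike (hkB : Measurable (uncurry kB))
    (hK : Measurable (uncurry K)) (hCB : ∀ x y, ‖kB x y‖ ≤ CB) (hC : ∀ x y, ‖K x y‖ ≤ C) (M : ℕ) :
    ∫ V : Fin (M + 3) → Y, kB (V 0) (V 1) * ∏ t : Fin (M + 2), K (V t.succ) (V (t.succ + 1))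
        ∂(Measure.pi fun _ => ρ) =
      ∫ x, ∫ y, kB x y * (fun f : Y → 𝕜 => fun w => ∫ z, K w z * f z ∂ρ)^[M + 1] (fun z => K z x) y
        ∂ρ ∂ρ := by
  have hC0 : ∀ y : Y, 0 ≤ C := fun y => (norm_nonneg _).trans (hC y y)
  have hCB0 : ∀ y : Y, 0 ≤ CB := fun y => (norm_nonneg _).trans (hCB y y)
  -- Step 1: peel site `0`
  have hΦm : Measurable fun V : Fin (M + 3) → Y =>
      kB (V 0) (V 1) * ∏ t : Fin (M + 2), K (V t.succ) (V (t.succ + 1)) := by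
    refine (hkB.comp ((measurable_pi_apply (X := fun _ : Fin (M + 3) => Y) 0).prodMk
      (measurable_pi_apply (X := fun _ : Fin (M + 3) => Y) 1))).mul ?_
    refine Finset.measurable_prod _ fun t _ => ?_
    exact hK.comp ((measurable_pi_apply (X := fun _ : Fin (M + 3) => Y) t.succ).prodMk
      (measurable_pi_apply (X := fun _ : Fin (M + 3) => Y) (t.succ + 1)))
  have hΦb : ∀ V : Fin (M + 3) → Y,
      ‖kB (V 0) (V 1) * ∏ t : Fin (M + 2), K (V t.succ) (V (t.succ + 1))‖ ≤ CB * C ^ (M + 2) := by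
    intro V
    have hP : ‖∏ t : Fin (M + 2), K (V t.succ) (V (t.succ + 1))‖ ≤ C ^ (M + 2) := by
      calc ‖∏ t : Fin (M + 2), K (V t.succ) (V (t.succ + 1))‖
          ≤ ∏ t : Fin (M + 2), ‖K (V t.succ) (V (t.succ + 1))‖ := Finset.norm_prod_le _ _
        _ ≤ ∏ _t : Fin (M + 2), C := Finset.prod_le_prod (fun t _ => norm_nonneg _) fun t _ => hC _ _
        _ = C ^ (M + 2) := by simp
    rw [norm_mul]
    exact mul_le_mul (hCB _ _) hP (norm_nonneg _) (hCB0 (V 0))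
  rw [integral_pi_succ_eq_integral_cons_rclike (ρ := ρ) (M + 2) hΦm hΦb]
  refine integral_congr_ae (Eventually.of_forall fun x => ?_)
  dsimp only
  simp_rw [prod_cyclic_succ_cons K M x, Fin.cons_zero, Fin.cons_one]
  -- Step 2: peel site `1`
  have hΨm : Measurable fun ζ : Fin (M + 2) → Y => kB x (ζ 0) *
      ((∏ i : Fin (M + 1), K (ζ (Fin.castSucc i)) (ζ i.succ)) * K (ζ (Fin.last (M + 1))) x) := by
    refine (hkB.comp (measurable_const.prodMk
      (measurable_pi_apply (X := fun _ : Fin (M + 2) => Y) 0))).mul (Measurable.mul ?_ ?_)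
    · refine Finset.measurable_prod _ fun i _ => ?_
      exact hK.comp ((measurable_pi_apply (X := fun _ : Fin (M + 2) => Y) (Fin.castSucc i)).prodMk
        (measurable_pi_apply (X := fun _ : Fin (M + 2) => Y) i.succ))
    · exact hK.comp ((measurable_pi_apply (X := fun _ : Fin (M + 2) => Y) (Fin.last (M + 1))).prodMk
        measurable_const)
  have hΨb : ∀ ζ : Fin (M + 2) → Y, ‖kB x (ζ 0) *
      ((∏ i : Fin (M + 1), K (ζ (Fin.castSucc i)) (ζ i.succ)) * K (ζ (Fin.last (M + 1))) x)‖ ≤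
        CB * (C ^ (M + 1) * C) := by
    intro ζ
    have hP : ‖∏ i : Fin (M + 1), K (ζ (Fin.castSucc i)) (ζ i.succ)‖ ≤ C ^ (M + 1) := by
      calc ‖∏ i : Fin (M + 1), K (ζ (Fin.castSucc i)) (ζ i.succ)‖
          ≤ ∏ i : Fin (M + 1), ‖K (ζ (Fin.castSucc i)) (ζ i.succ)‖ := Finset.norm_prod_le _ _
        _ ≤ ∏ _i : Fin (M + 1), C := Finset.prod_le_prod (fun i _ => norm_nonneg _) fun i _ => hC _ _
        _ = C ^ (M + 1) := by simp
    rw [norm_mul, norm_mul]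
    exact mul_le_mul (hCB _ _) (mul_le_mul hP (hC _ _) (norm_nonneg _) (pow_nonneg (hC0 x) _))
      (mul_nonneg (norm_nonneg _) (norm_nonneg _)) (hCB0 x)
  rw [integral_pi_succ_eq_integral_cons_rclike (ρ := ρ) (M + 1) hΨm hΨb]
  refine integral_congr_ae (Eventually.of_forall fun y => ?_)
  dsimp only
  simp only [Fin.cons_zero, Fin.cons_succ]
  rw [integral_const_mul, integral_pathWeight_mul_kernel_last_eq_iterate_rclike (ρ := ρ) hK hC x (M + 1) y]

end Peeling

/-! ### The one-variable pointwise expansion -/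

variable {𝕜 : Type*} [RCLike 𝕜] {X : Type*} [MeasurableSpace X] {μ : Measure X} [IsFiniteMeasure μ]
  {K : X → X → 𝕜} {C : ℝ} {A : Lp 𝕜 2 μ →L[𝕜] Lp 𝕜 2 μ} {ι : Type*}
  {b : HilbertBasis ι 𝕜 (Lp 𝕜 2 μ)} {lam : ι → ℝ} {kB : X → X → 𝕜} {CB : ℝ}

/-- **`⟪conj k_B(u, ·), A^j [h]⟫ = ∫ k_B(u, y) (κ^[j] h)(y) dμ(y)`**: pairing a power of the `K`-operator `A`,
applied to the class of a bounded measurable `h`, with the `L²` section of ANOTHER bounded kernel `k_B`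
performs one honest `k_B`-integration of the iterate `κ^[j] h` (`pow_kernelOp_toLp_ae_eq_iterate_rclike`).
[folklore] -/
theorem inner_conj_section_pow_kernelOp_of_kernel (hkB : StronglyMeasurable (uncurry kB))
    (hCB : ∀ x y, ‖kB x y‖ ≤ CB)
    (hA : ∀ φ : Lp 𝕜 2 μ, (A φ : X → 𝕜) =ᵐ[μ] fun x => ∫ y, K x y * φ y ∂μ)
    {h : X → 𝕜} (hh : Measurable h) {Bh : ℝ} (hhb : ∀ x, ‖h x‖ ≤ Bh) (j : ℕ) (u : X) :
    ⟪(memLp_two_conj_kernel_section (μ := μ) hkB hCB u).toLp (fun y => conj (kB u y)),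
        (A ^ j) ((memLp_two_of_bound_rclike (μ := μ) hh hhb).toLp h)⟫_𝕜 =
      ∫ y, kB u y * ((fun f : X → 𝕜 => fun x => ∫ z, K x z * f z ∂μ)^[j] h) y ∂μ := by
  rw [← integral_kernel_mul_eq_inner hkB hCB u]
  refine integral_congr_ae ?_
  filter_upwards [pow_kernelOp_toLp_ae_eq_iterate_rclike hA hh hhb j] with y hy
  rw [hy]

/-- **One-variable pointwise expansion of the sandwiched iterated kernel**: for EVERY `x`,
`∫ k_B(x, y) (κ^[j] K(·, x))(y) dμ(y) = Σᵢ λᵢ^j (κ_B bᵢ)(x) conj((κ bᵢ)(x))`, where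
`(κ_B bᵢ)(x) = ∫ k_B(x, z) bᵢ(z) dμ(z)` and `(κ bᵢ)(x) = ∫ K(x, z) bᵢ(z) dμ(z)` (Hermitian symmetry
`K(·, x) = conj K(x, ·)`, `A^j [conj K(x, ·)] =ᵐ κ^[j] K(·, x)`, Parseval in the eigenbasis, self-adjointness
of `A^j` and real eigenvalues). [folklore] -/
theorem hasSum_integral_kernel_mul_iterate (hK : StronglyMeasurable (uncurry K))
    (hC : ∀ x y, ‖K x y‖ ≤ C) (hherm : ∀ x y, K x y = conj (K y x))
    (hA : ∀ φ : Lp 𝕜 2 μ, (A φ : X → 𝕜) =ᵐ[μ] fun x => ∫ y, K x y * φ y ∂μ)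
    (hb : ∀ i, A (b i) = (lam i : 𝕜) • b i) (hkB : StronglyMeasurable (uncurry kB))
    (hCB : ∀ x y, ‖kB x y‖ ≤ CB) (j : ℕ) (x : X) :
    HasSum (fun i => (lam i : 𝕜) ^ j * ((∫ z, kB x z * b i z ∂μ) * conj (∫ z, K x z * b i z ∂μ)))
      (∫ y, kB x y * ((fun f : X → 𝕜 => fun w => ∫ z, K w z * f z ∂μ)^[j] (fun z => K z x)) y ∂μ) := by
  set kx : Lp 𝕜 2 μ := (memLp_two_conj_kernel_section (μ := μ) hK hC x).toLp (fun z => conj (K x z))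
    with hkx
  set βx : Lp 𝕜 2 μ := (memLp_two_conj_kernel_section (μ := μ) hkB hCB x).toLp (fun z => conj (kB x z))
    with hβx
  have hKx : (fun z => K z x) = fun z => conj (K x z) := funext fun z => hherm z x
  have e1 : ∫ y, kB x y * ((fun f : X → 𝕜 => fun w => ∫ z, K w z * f z ∂μ)^[j] (fun z => K z x)) y ∂μ =
      ⟪βx, (A ^ j) kx⟫_𝕜 := by
    rw [hKx]
    exact (inner_conj_section_pow_kernelOp_of_kernel hkB hCB hA (measurable_conj_kernel_section hK x)
      (norm_conj_kernel_section_le hC x) j x).symm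
  rw [e1]
  have hsa : IsSelfAdjoint (A ^ j) := (isSelfAdjoint_of_ae_hermitianKernel hK hC hherm hA).pow j
  have h := b.hasSum_inner_mul_inner βx ((A ^ j) kx)
  refine h.congr_fun fun i => ?_
  have h2 : ⟪b i, (A ^ j) kx⟫_𝕜 = (lam i : 𝕜) ^ j * ⟪b i, kx⟫_𝕜 := by
    rw [← hsa.adjoint_eq, ContinuousLinearMap.adjoint_inner_right, pow_apply_basis_rclike hb j i,
      inner_smul_left, ← RCLike.ofReal_pow, RCLike.conj_ofReal, RCLike.ofReal_pow]
  rw [h2, ← inner_conj_symm (b i) kx, ← integral_kernel_mul_eq_inner hK hC x (b i),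
    ← integral_kernel_mul_eq_inner hkB hCB x (b i)]
  ring

/-! ### The sandwiched trace formula -/

/-- **Sandwiched-insertion trace formula, diagonal form.**  For a bounded Hermitian kernel `K` with `L²`
operator `A`, a countable Hilbert basis of eigenvectors `A bᵢ = λᵢ bᵢ` (real `λᵢ`), a bounded operator `B`
whose sandwich `A B A` is given a.e. by the bounded strongly measurable kernel `k_B`, and every `M`:
`Σᵢ λᵢ^{M+4} ⟪bᵢ, B bᵢ⟫ = ∫∫ k_B(x, y) (κ^[M+1] K(·, x))(y) dμ(y) dμ(x)` ("`Tr(B A^{M+4})`" as the diagonal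
integral of the kernel of `(ABA) A^{M+2}`): the pointwise expansion `hasSum_integral_kernel_mul_iterate`
integrated by dominated convergence (dominant `‖A‖^{M+1} (|(κ_B bᵢ)(x)|² + |(κ bᵢ)(x)|²)`, summing to at most
`‖A‖^{M+1} (C_B² + C²) μ(X)` by Bessel), and the terms identified through `κ bᵢ =ᵐ λᵢ bᵢ`,
`κ_B bᵢ =ᵐ A B A bᵢ`, `⟪bᵢ, A B A bᵢ⟫ = ⟪A bᵢ, B A bᵢ⟫ = λᵢ² ⟪bᵢ, B bᵢ⟫`. [folklore] -/
theorem hasSum_pow_inner_sandwich_diag_rclike [Countable ι] (hK : StronglyMeasurable (uncurry K))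
    (hC : ∀ x y, ‖K x y‖ ≤ C) (hherm : ∀ x y, K x y = conj (K y x))
    (hA : ∀ φ : Lp 𝕜 2 μ, (A φ : X → 𝕜) =ᵐ[μ] fun x => ∫ y, K x y * φ y ∂μ)
    (hb : ∀ i, A (b i) = (lam i : 𝕜) • b i) {B : Lp 𝕜 2 μ →L[𝕜] Lp 𝕜 2 μ}
    (hkB : StronglyMeasurable (uncurry kB)) (hCB : ∀ x y, ‖kB x y‖ ≤ CB)
    (hABA : ∀ φ : Lp 𝕜 2 μ, ((A.comp (B.comp A)) φ : X → 𝕜) =ᵐ[μ] fun x => ∫ y, kB x y * φ y ∂μ)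
    (M : ℕ) :
    HasSum (fun i => (lam i : 𝕜) ^ (M + 4) * ⟪(b i : Lp 𝕜 2 μ), B (b i)⟫_𝕜)
      (∫ x, ∫ y, kB x y * ((fun f : X → 𝕜 => fun w => ∫ z, K w z * f z ∂μ)^[M + 1] (fun z => K z x)) y
        ∂μ ∂μ) := by
  -- notation: `cf i x = (κ bᵢ)(x)`, `cB i x = (κ_B bᵢ)(x)`, terms `F`, dominant `bd`
  set cf : ι → X → 𝕜 := fun i x => ∫ z, K x z * b i z ∂μ with hcf
  set cB : ι → X → 𝕜 := fun i x => ∫ z, kB x z * b i z ∂μ with hcB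
  set F : ι → X → 𝕜 := fun i x => (lam i : 𝕜) ^ (M + 1) * (cB i x * conj (cf i x)) with hF
  set bd : ι → X → ℝ := fun i x => ‖A‖ ^ (M + 1) * (‖cB i x‖ ^ 2 + ‖cf i x‖ ^ 2) with hbd
  have hcfm : ∀ i, Measurable (cf i) := fun i => (stronglyMeasurable_integral_kernel_mul hK (b i)).measurable
  have hcBm : ∀ i, Measurable (cB i) := fun i =>
    (stronglyMeasurable_integral_kernel_mul hkB (b i)).measurable
  have hFm : ∀ i, Measurable (F i) := fun i =>
    ((hcBm i).mul (RCLike.continuous_conj.measurable.comp (hcfm i))).const_mul _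
  have hlamA : ∀ i, ‖(lam i : 𝕜)‖ ≤ ‖A‖ := norm_eigval_le_opNorm hb
  -- (0) pointwise expansion
  have hpt : ∀ x, HasSum (fun i => F i x)
      (∫ y, kB x y * ((fun f : X → 𝕜 => fun w => ∫ z, K w z * f z ∂μ)^[M + 1] (fun z => K z x)) y ∂μ) :=
    fun x => hasSum_integral_kernel_mul_iterate hK hC hherm hA hb hkB hCB (M + 1) x
  -- (1) domination
  have hbound : ∀ i x, ‖F i x‖ ≤ bd i x := fun i x => by
    simp only [hF, hbd]
    rw [norm_mul, norm_mul, norm_pow, RCLike.norm_conj]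
    have h2 : ‖(lam i : 𝕜)‖ ^ (M + 1) ≤ ‖A‖ ^ (M + 1) := pow_le_pow_left₀ (norm_nonneg _) (hlamA i) _
    have h3 : ‖cB i x‖ * ‖cf i x‖ ≤ ‖cB i x‖ ^ 2 + ‖cf i x‖ ^ 2 := by
      nlinarith [two_mul_le_add_sq ‖cB i x‖ ‖cf i x‖, mul_nonneg (norm_nonneg (cB i x))
        (norm_nonneg (cf i x))]
    exact mul_le_mul h2 h3 (by positivity) (by positivity)
  have hparsK : ∀ x, Summable (fun i => ‖cf i x‖ ^ 2) ∧ ∑' i, ‖cf i x‖ ^ 2 = ∫ z, ‖K x z‖ ^ 2 ∂μ ∧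
      ∫ z, ‖K x z‖ ^ 2 ∂μ ≤ C ^ 2 * μ.real univ := fun x => tsum_norm_sq_integral_kernel_mul_le hK hC b x
  have hparsB : ∀ x, Summable (fun i => ‖cB i x‖ ^ 2) ∧ ∑' i, ‖cB i x‖ ^ 2 = ∫ z, ‖kB x z‖ ^ 2 ∂μ ∧
      ∫ z, ‖kB x z‖ ^ 2 ∂μ ≤ CB ^ 2 * μ.real univ := fun x =>
    tsum_norm_sq_integral_kernel_mul_le hkB hCB b x
  have hbd_sum : ∀ x, Summable fun i => bd i x := fun x =>
    ((hparsB x).1.add (hparsK x).1).mul_left _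
  have hsqK : Measurable fun x => ∫ z, ‖K x z‖ ^ 2 ∂μ :=
    (stronglyMeasurable_integral_norm_kernel_sq hK).measurable
  have hsqB : Measurable fun x => ∫ z, ‖kB x z‖ ^ 2 ∂μ :=
    (stronglyMeasurable_integral_norm_kernel_sq hkB).measurable
  have hbd_int : Integrable (fun x => ∑' i, bd i x) μ := by
    have hfun : (fun x => ∑' i, bd i x) =
        fun x => ‖A‖ ^ (M + 1) * (∫ z, ‖kB x z‖ ^ 2 ∂μ + ∫ z, ‖K x z‖ ^ 2 ∂μ) := by
      funext x
      simp only [hbd]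
      rw [tsum_mul_left, (hparsB x).1.tsum_add (hparsK x).1, (hparsB x).2.1, (hparsK x).2.1]
    rw [hfun]
    refine (Integrable.of_bound (hsqB.add hsqK).aestronglyMeasurable ((CB ^ 2 + C ^ 2) * μ.real univ)
      (Eventually.of_forall fun x => ?_)).const_mul _
    rw [Real.norm_eq_abs, abs_of_nonneg (add_nonneg (integral_nonneg fun z => by positivity)
      (integral_nonneg fun z => by positivity))]
    calc ∫ z, ‖kB x z‖ ^ 2 ∂μ + ∫ z, ‖K x z‖ ^ 2 ∂μ ≤ CB ^ 2 * μ.real univ + C ^ 2 * μ.real univ :=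
          add_le_add (hparsB x).2.2 (hparsK x).2.2
      _ = (CB ^ 2 + C ^ 2) * μ.real univ := by ring
  have key := hasSum_integral_of_dominated_convergence (μ := μ) bd
    (fun i => (hFm i).aestronglyMeasurable) (fun i => Eventually.of_forall (hbound i))
    (Eventually.of_forall hbd_sum) hbd_int (Eventually.of_forall hpt)
  -- (2) the terms: `∫ λᵢ^{M+1} (κ_B bᵢ) conj(κ bᵢ) = λᵢ^{M+4} ⟪bᵢ, B bᵢ⟫`
  have hsa : IsSelfAdjoint A := isSelfAdjoint_of_ae_hermitianKernel hK hC hherm hA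
  refine key.congr_fun fun i => ?_
  have hI : ∫ x, cB i x * conj (cf i x) ∂μ = (lam i : 𝕜) * ⟪b i, (A.comp (B.comp A)) (b i)⟫_𝕜 := by
    rw [inner_eq_integral_of_ae_kernel hABA (b i) (b i), ← integral_const_mul]
    refine integral_congr_ae ?_
    filter_upwards [integral_kernel_mul_basis_ae_eq hA hb i] with x hx
    simp only [hcB, hcf] at hx ⊢
    rw [hx, map_mul, RCLike.conj_ofReal]
    ring
  have hABAi : ⟪b i, (A.comp (B.comp A)) (b i)⟫_𝕜 = (lam i : 𝕜) ^ 2 * ⟪b i, B (b i)⟫_𝕜 := by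
    have h0 := ContinuousLinearMap.adjoint_inner_left A (B (A (b i))) (b i)
    rw [hsa.adjoint_eq] at h0
    rw [ContinuousLinearMap.comp_apply, ContinuousLinearMap.comp_apply, ← h0, hb i, map_smul,
      inner_smul_left, inner_smul_right, RCLike.conj_ofReal]
    ring
  simp only [hF]
  rw [integral_const_mul, hI, hABAi]
  ring

/-- **Sandwiched-insertion trace formula as a periodic path integral** (`RCLike` scalars).  For a bounded,
strongly measurable, Hermitian kernel `K` on a finite measure space with `L²` operator `A`, a countable Hilbert
basis of eigenvectors `A bᵢ = λᵢ bᵢ` (real `λᵢ`), ANY bounded operator `B` such that `A B A` is given a.e. by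
a bounded strongly measurable kernel `k_B`, and every `M`:
`Σᵢ λᵢ^{M+4} ⟪bᵢ, B bᵢ⟫ = ∫ k_B(V 0, V 1) ∏_{t : Fin (M+2)} K(V (t+1), V (t+2)) dμ^{⊗(M+3)}(V)` — the cyclic
integral of the kernels `k_B, K, …, K` (`M + 2` copies of `K`, the last bond `K(V (M+2), V 0)`), i.e.
"`Tr(B A^{M+4})`" without trace-class theory (`integral_cyclic_bond_insert_eq_integral_iterate_rclike` and
`hasSum_pow_inner_sandwich_diag_rclike`). [folklore] -/
theorem hasSum_pow_inner_sandwich_rclike [Countable ι] (hK : StronglyMeasurable (uncurry K))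
    (hC : ∀ x y, ‖K x y‖ ≤ C) (hherm : ∀ x y, K x y = conj (K y x))
    (hA : ∀ φ : Lp 𝕜 2 μ, (A φ : X → 𝕜) =ᵐ[μ] fun x => ∫ y, K x y * φ y ∂μ)
    (hb : ∀ i, A (b i) = (lam i : 𝕜) • b i) {B : Lp 𝕜 2 μ →L[𝕜] Lp 𝕜 2 μ}
    (hkB : StronglyMeasurable (uncurry kB)) (hCB : ∀ x y, ‖kB x y‖ ≤ CB)
    (hABA : ∀ φ : Lp 𝕜 2 μ, ((A.comp (B.comp A)) φ : X → 𝕜) =ᵐ[μ] fun x => ∫ y, kB x y * φ y ∂μ)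
    (M : ℕ) :
    HasSum (fun i => (lam i : 𝕜) ^ (M + 4) * ⟪(b i : Lp 𝕜 2 μ), B (b i)⟫_𝕜)
      (∫ V : Fin (M + 3) → X, kB (V 0) (V 1) * ∏ t : Fin (M + 2), K (V t.succ) (V (t.succ + 1))
        ∂(Measure.pi fun _ => μ)) := by
  rw [integral_cyclic_bond_insert_eq_integral_iterate_rclike (ρ := μ) hkB.measurable hK.measurable hCB hC M]
  exact hasSum_pow_inner_sandwich_diag_rclike hK hC hherm hA hb hkB hCB hABA M

/-- **Sandwiched-insertion trace formula for a bounded Hermitian complex kernel.**  For `K : X → X → ℂ`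
strongly measurable, bounded and Hermitian on a finite measure space, ANY bounded operator `T` on
`L²(X, μ; ℂ)` with `(Tφ)(x) = ∫ K(x, y) φ(y) dμ(y)` a.e. (compact self-adjoint, `exists_hermitianKernelOp`),
any countable Hilbert basis `e` of eigenvectors with real eigenvalues `ev`, any bounded operator `S` whose
sandwich `T S T` has a bounded strongly measurable kernel `kS`, and every `M`:
`Σᵢ evᵢ^{M+4} ⟪eᵢ, S eᵢ⟫ = ∫ kS(V 0, V 1) ∏_{t : Fin (M+2)} K(V (t+1), V (t+2)) dμ^{⊗(M+3)}(V)`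
("`Tr(S T^{M+4})`"; `hasSum_pow_inner_sandwich_rclike` at `𝕜 = ℂ`, `conj = starRingEnd ℂ`; B. Simon,
*Trace Ideals* (2005), Ch. 3; Reed–Simon I, §VI.6). [folklore] -/
theorem hasSum_pow_inner_sandwich : ∀ {X : Type*} [MeasurableSpace X] (μ : Measure X)
    [IsFiniteMeasure μ] (K : X → X → ℂ) (C : ℝ), StronglyMeasurable (uncurry K) → (∀ x y, ‖K x y‖ ≤ C) →
    (∀ x y, K x y = conj (K y x)) →
    ∀ (T : Lp ℂ 2 μ →L[ℂ] Lp ℂ 2 μ),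
      (∀ φ : Lp ℂ 2 μ, (T φ : X → ℂ) =ᵐ[μ] fun x => ∫ y, K x y * φ y ∂μ) →
      ∀ {ι : Type*} [Countable ι] (e : HilbertBasis ι ℂ (Lp ℂ 2 μ)) (ev : ι → ℝ),
        (∀ i, T (e i) = (ev i : ℂ) • (e i : Lp ℂ 2 μ)) →
        ∀ (S : Lp ℂ 2 μ →L[ℂ] Lp ℂ 2 μ) (kS : X → X → ℂ) (CS : ℝ),
          StronglyMeasurable (uncurry kS) → (∀ x y, ‖kS x y‖ ≤ CS) →
          (∀ φ : Lp ℂ 2 μ, ((T.comp (S.comp T)) φ : X → ℂ) =ᵐ[μ] fun x => ∫ y, kS x y * φ y ∂μ) →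
          ∀ M : ℕ, HasSum (fun i => (ev i : ℂ) ^ (M + 4) * ⟪(e i : Lp ℂ 2 μ), S (e i)⟫_ℂ)
            (∫ V : Fin (M + 3) → X, kS (V 0) (V 1) * ∏ t : Fin (M + 2), K (V t.succ) (V (t.succ + 1))
              ∂(Measure.pi fun _ => μ)) := by
  intro X _ μ _ K C hK hC hherm T hT ι _ e ev he S kS CS hkS hCS hTST M
  exact hasSum_pow_inner_sandwich_rclike hK hC hherm hT he hkS hCS hTST M

end Summit.QuantumFields.YangMills.Cruxes.IRcof.EquipartitionSeam.SpectralDict.SandwichCopy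

namespace Summit.QuantumFields.YangMills.Cruxes.IRcof.EquipartitionSeam.SpectralDict

variable {X : Type*} [MeasurableSpace X] {μ : Measure X}

/-! ## §1 Koopman operators of measure-preserving maps on `L²(X, μ; ℂ)` -/

/-- The Koopman operator `U_T φ = φ ∘ T` of a measure-preserving map `T`, a linear isometry of `L²(μ; ℂ)`. -/
def koop (T : X → X) (hT : MeasurePreserving T μ μ) : Lp ℂ 2 μ →L[ℂ] Lp ℂ 2 μ :=
  (Lp.compMeasurePreservingₗᵢ ℂ T hT).toContinuousLinearMap

theorem koop_apply {T : X → X} (hT : MeasurePreserving T μ μ) (φ : Lp ℂ 2 μ) :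
    koop T hT φ = Lp.compMeasurePreserving T hT φ := rfl

theorem coeFn_koop {T : X → X} (hT : MeasurePreserving T μ μ) (φ : Lp ℂ 2 μ) :
    (koop T hT φ : X → ℂ) =ᵐ[μ] fun x => φ (T x) :=
  Lp.coeFn_compMeasurePreserving φ hT

theorem norm_koop_apply {T : X → X} (hT : MeasurePreserving T μ μ) (φ : Lp ℂ 2 μ) :
    ‖koop T hT φ‖ = ‖φ‖ :=
  Lp.norm_compMeasurePreserving φ hT

theorem norm_koop_le {T : X → X} (hT : MeasurePreserving T μ μ) : ‖koop T hT‖ ≤ 1 :=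
  ContinuousLinearMap.opNorm_le_bound _ zero_le_one fun φ => by rw [norm_koop_apply, one_mul]

/-- Integrals are invariant under a measure-preserving map. -/
theorem integral_comp_mp {T : X → X} (hT : MeasurePreserving T μ μ) {g : X → ℂ}
    (hg : AEStronglyMeasurable g μ) : ∫ x, g (T x) ∂μ = ∫ x, g x ∂μ := by
  have h := integral_map (μ := μ) hT.measurable.aemeasurable (f := g) (by rw [hT.map_eq]; exact hg)
  rw [hT.map_eq] at h
  exact h.symm

/-- Pull-back of an a.e. equality along a measure-preserving map. -/
theorem ae_eq_comp_mp {T : X → X} (hT : MeasurePreserving T μ μ) {f g : X → ℂ} (h : f =ᵐ[μ] g) :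
    (fun x => f (T x)) =ᵐ[μ] fun x => g (T x) :=
  hT.quasiMeasurePreserving.ae_eq_comp h

/-! ## §2 A finite group of measure-preserving twists: the unitary representation `U` and its commutation with
the kernel operator -/

section Group

variable {Γ : Type*} [Group Γ] {T : Γ → X → X}

omit [MeasurableSpace X] in
theorem apply_inv_apply_of_hom (hT1 : T 1 = id) (hTmul : ∀ a b, T (a * b) = T a ∘ T b) (a : Γ) (x : X) :
    T a (T a⁻¹ x) = x := by
  have h := congrFun (hTmul a a⁻¹) x
  rw [mul_inv_cancel, hT1] at h
  exact h.symm

omit [MeasurableSpace X] in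
theorem inv_apply_apply_of_hom (hT1 : T 1 = id) (hTmul : ∀ a b, T (a * b) = T a ∘ T b) (a : Γ) (x : X) :
    T a⁻¹ (T a x) = x := by
  have h := congrFun (hTmul a⁻¹ a) x
  rw [inv_mul_cancel, hT1] at h
  exact h.symm

variable (hTm : ∀ c, MeasurePreserving (T c) μ μ)

/-- `U_c U_d = U_{dc}` (`φ ∘ T_d ∘ T_c = φ ∘ T_{dc}`). -/
theorem koop_mul_koop (hTmul : ∀ a b, T (a * b) = T a ∘ T b) (c d : Γ) :
    koop (T c) (hTm c) * koop (T d) (hTm d) = koop (T (d * c)) (hTm (d * c)) := by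
  refine ContinuousLinearMap.ext fun φ => Lp.ext ?_
  rw [mul_apply_eq_comp]
  refine (coeFn_koop (hTm c) _).trans ?_
  refine (ae_eq_comp_mp (hTm c) (coeFn_koop (hTm d) φ)).trans ?_
  refine ((coeFn_koop (hTm (d * c)) φ).trans ?_).symm
  exact Eventually.of_forall fun x => by simp only [hTmul d c, Function.comp_apply]

theorem koop_one (hT1 : T 1 = id) : koop (T 1) (hTm 1) = (1 : Lp ℂ 2 μ →L[ℂ] Lp ℂ 2 μ) := by
  refine ContinuousLinearMap.ext fun φ => Lp.ext ?_
  refine (coeFn_koop (hTm 1) φ).trans (Eventually.of_forall fun x => ?_)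
  simp [hT1]

theorem koop_comm (hTmul : ∀ a b, T (a * b) = T a ∘ T b) (hcomm : ∀ a b : Γ, a * b = b * a) (c d : Γ) :
    koop (T c) (hTm c) * koop (T d) (hTm d) = koop (T d) (hTm d) * koop (T c) (hTm c) := by
  rw [koop_mul_koop hTm hTmul, koop_mul_koop hTm hTmul]
  have h : d * c = c * d := hcomm d c
  simp only [h]

/-- `U_{c⁻¹} = U_c^*` (change of variables `x ↦ T_c x` in `⟪U_{c⁻¹} φ, ψ⟫`). -/
theorem adjoint_koop (hT1 : T 1 = id) (hTmul : ∀ a b, T (a * b) = T a ∘ T b) (c : Γ) :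
    ContinuousLinearMap.adjoint (koop (T c) (hTm c)) = koop (T c⁻¹) (hTm c⁻¹) := by
  symm
  rw [ContinuousLinearMap.eq_adjoint_iff]
  intro φ ψ
  rw [L2.inner_def, L2.inner_def]
  have h1 : ∫ x, ⟪(koop (T c⁻¹) (hTm c⁻¹) φ : X → ℂ) x, (ψ : X → ℂ) x⟫_ℂ ∂μ =
      ∫ x, conj ((φ : X → ℂ) (T c⁻¹ x)) * (ψ : X → ℂ) x ∂μ := by
    refine integral_congr_ae ?_
    filter_upwards [coeFn_koop (hTm c⁻¹) φ] with x hx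
    rw [hx, RCLike.inner_apply']
  have h2 : ∫ x, ⟪(φ : X → ℂ) x, (koop (T c) (hTm c) ψ : X → ℂ) x⟫_ℂ ∂μ =
      ∫ x, conj ((φ : X → ℂ) x) * (ψ : X → ℂ) (T c x) ∂μ := by
    refine integral_congr_ae ?_
    filter_upwards [coeFn_koop (hTm c) ψ] with x hx
    rw [hx, RCLike.inner_apply']
  rw [h1, h2]
  -- substitute `x = T_c u` in the first integral
  have hg : AEStronglyMeasurable (fun x => conj ((φ : X → ℂ) (T c⁻¹ x)) * (ψ : X → ℂ) x) μ :=
    (RCLike.continuous_conj.comp_aestronglyMeasurable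
      ((Lp.aestronglyMeasurable φ).comp_measurePreserving (hTm c⁻¹))).mul (Lp.aestronglyMeasurable ψ)
  rw [← integral_comp_mp (hTm c) hg]
  refine integral_congr_ae (Eventually.of_forall fun u => ?_)
  simp only [inv_apply_apply_of_hom hT1 hTmul]

theorem star_koop (hT1 : T 1 = id) (hTmul : ∀ a b, T (a * b) = T a ∘ T b) (c : Γ) :
    star (koop (T c) (hTm c)) = koop (T c⁻¹) (hTm c⁻¹) := by
  rw [ContinuousLinearMap.star_eq_adjoint, adjoint_koop hTm hT1 hTmul]

omit [Group Γ] in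
/-- `⟪bᵢ, U_c bᵢ⟫` has norm at most one. -/
theorem norm_inner_koop_le (c : Γ) (φ : Lp ℂ 2 μ) (hφ : ‖φ‖ = 1) :
    ‖⟪φ, koop (T c) (hTm c) φ⟫_ℂ‖ ≤ 1 := by
  calc ‖⟪φ, koop (T c) (hTm c) φ⟫_ℂ‖ ≤ ‖φ‖ * ‖koop (T c) (hTm c) φ‖ := norm_inner_le_norm _ _
    _ = 1 := by rw [norm_koop_apply, hφ, mul_one]

variable {K : X → X → ℂ} {A : Lp ℂ 2 μ →L[ℂ] Lp ℂ 2 μ}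

omit [Group Γ] in
/-- **The twists commute with the kernel operator**: `K(T_c x, T_c y) = K(x, y)` gives `A U_c = U_c A`. -/
theorem kernelOp_mul_koop (hK : StronglyMeasurable (uncurry K))
    (hA : ∀ φ : Lp ℂ 2 μ, (A φ : X → ℂ) =ᵐ[μ] fun x => ∫ y, K x y * φ y ∂μ)
    (hKT : ∀ c x y, K (T c x) (T c y) = K x y) (c : Γ) :
    A * koop (T c) (hTm c) = koop (T c) (hTm c) * A := by
  refine ContinuousLinearMap.ext fun φ => Lp.ext ?_
  have h1 : ((A * koop (T c) (hTm c)) φ : X → ℂ) =ᵐ[μ]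
      fun x => ∫ y, K x y * (koop (T c) (hTm c) φ : X → ℂ) y ∂μ := by
    rw [mul_apply_eq_comp]; exact hA _
  have h2 : ∀ x, ∫ y, K x y * (koop (T c) (hTm c) φ : X → ℂ) y ∂μ = ∫ y, K x y * (φ : X → ℂ) (T c y) ∂μ :=
    fun x => integral_congr_ae (by filter_upwards [coeFn_koop (hTm c) φ] with y hy; rw [hy])
  have h3 : ∀ x, ∫ y, K x y * (φ : X → ℂ) (T c y) ∂μ = ∫ y, K (T c x) y * (φ : X → ℂ) y ∂μ := by
    intro x
    have hg : AEStronglyMeasurable (fun y => K (T c x) y * (φ : X → ℂ) y) μ :=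
      (hK.of_uncurry_left (x := T c x)).aestronglyMeasurable.mul (Lp.aestronglyMeasurable φ)
    rw [← integral_comp_mp (hTm c) hg]
    refine integral_congr_ae (Eventually.of_forall fun y => ?_)
    simp only [hKT]
  have h4 : ((koop (T c) (hTm c) * A) φ : X → ℂ) =ᵐ[μ] fun x => (A φ : X → ℂ) (T c x) := by
    rw [mul_apply_eq_comp]; exact coeFn_koop _ _
  have h5 : (fun x => (A φ : X → ℂ) (T c x)) =ᵐ[μ] fun x => ∫ y, K (T c x) y * (φ : X → ℂ) y ∂μ :=
    ae_eq_comp_mp (hTm c) (hA φ)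
  have h23 : (fun x => ∫ y, K x y * (koop (T c) (hTm c) φ : X → ℂ) y ∂μ) =
      fun x => ∫ y, K (T c x) y * (φ : X → ℂ) y ∂μ := funext fun x => by rw [h2 x, h3 x]
  rw [h23] at h1
  exact h1.trans (h4.trans h5).symm

end Group


/-! ## §3 The joint eigenbasis of the kernel operator and the twists

For a compact self-adjoint positive `A` commuting with the unitary representation `U` of a COMMUTATIVE group of twists,
the family `A`, `A(U_c + U_c^*)`, `i·A(U_c − U_c^*)` is a commuting family of compact self-adjoint operators; a complete
orthonormal system of joint eigenvectors (tree: `JointSpectral.exists_orthonormal_dense_jointEigenvectors`) is an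
eigenbasis of `A` on which every `U_c` acts by a unit multiplicative character WHEREVER `λᵢ ≠ 0` (on `ker A` nothing is
claimed and the character is set to `1`; all trace formulas below carry a factor `λᵢ^{≥2}`). -/

section Joint

variable {Γ : Type*} [Group Γ] {T : Γ → X → X} (hTm : ∀ c, MeasurePreserving (T c) μ μ)

/-- The commuting compact self-adjoint family attached to `A` and the twists. -/
def jointFamily (A : Lp ℂ 2 μ →L[ℂ] Lp ℂ 2 μ) : Option (Γ × Bool) → (Lp ℂ 2 μ →L[ℂ] Lp ℂ 2 μ)
  | none => A
  | some (c, true) => A * (koop (T c) (hTm c) + koop (T c⁻¹) (hTm c⁻¹))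
  | some (c, false) => Complex.I • (A * (koop (T c) (hTm c) - koop (T c⁻¹) (hTm c⁻¹)))

variable (hT1 : T 1 = id) (hTmul : ∀ a b, T (a * b) = T a ∘ T b) (hcomm : ∀ a b : Γ, a * b = b * a)
  {A : Lp ℂ 2 μ →L[ℂ] Lp ℂ 2 μ} (hAsa : IsSelfAdjoint A) (hAc : IsCompactOperator A)
  (hAU : ∀ c, A * koop (T c) (hTm c) = koop (T c) (hTm c) * A)

include hT1 hTmul hAsa hAU in
theorem isSelfAdjoint_jointFamily (j : Option (Γ × Bool)) : IsSelfAdjoint (jointFamily hTm A j) := by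
  have hU : ∀ c, star (koop (T c) (hTm c)) = koop (T c⁻¹) (hTm c⁻¹) := star_koop hTm hT1 hTmul
  rcases j with _ | ⟨c, _ | _⟩
  · exact hAsa
  · -- `i A (U - U^*)`
    show IsSelfAdjoint (Complex.I • (A * (koop (T c) (hTm c) - koop (T c⁻¹) (hTm c⁻¹))))
    rw [IsSelfAdjoint, star_smul, star_mul, star_sub, hU, hU, inv_inv, hAsa.star_eq, Complex.star_def,
      Complex.conj_I, mul_sub, sub_mul, hAU, hAU, neg_smul, ← smul_neg, neg_sub]
  · show IsSelfAdjoint (A * (koop (T c) (hTm c) + koop (T c⁻¹) (hTm c⁻¹)))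
    rw [IsSelfAdjoint, star_mul, star_add, hU, hU, inv_inv, hAsa.star_eq, add_comm, mul_add, add_mul, hAU, hAU]

include hAc in
theorem isCompactOperator_jointFamily (j : Option (Γ × Bool)) : IsCompactOperator (jointFamily hTm A j) := by
  rcases j with _ | ⟨c, _ | _⟩
  · exact hAc
  · show IsCompactOperator (Complex.I • (A * (koop (T c) (hTm c) - koop (T c⁻¹) (hTm c⁻¹))))
    have h : IsCompactOperator (A * (koop (T c) (hTm c) - koop (T c⁻¹) (hTm c⁻¹))) := by
      rw [ContinuousLinearMap.mul_def]; exact hAc.comp_clm _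
    have h' := h.smul Complex.I
    rwa [← FunLike.coe_smul] at h'
  · show IsCompactOperator (A * (koop (T c) (hTm c) + koop (T c⁻¹) (hTm c⁻¹)))
    rw [ContinuousLinearMap.mul_def]; exact hAc.comp_clm _

include hTmul hcomm hAU in
theorem commute_jointFamily (i j : Option (Γ × Bool)) : Commute (jointFamily hTm A i) (jointFamily hTm A j) := by
  -- base commutations
  have hUU : ∀ c d, Commute (koop (T c) (hTm c)) (koop (T d) (hTm d)) := fun c d => koop_comm hTm hTmul hcomm c d
  have hAUc : ∀ c, Commute A (koop (T c) (hTm c)) := fun c => hAU c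
  set V : Γ → (Lp ℂ 2 μ →L[ℂ] Lp ℂ 2 μ) := fun c => koop (T c) (hTm c) + koop (T c⁻¹) (hTm c⁻¹) with hV
  set W : Γ → (Lp ℂ 2 μ →L[ℂ] Lp ℂ 2 μ) := fun c => koop (T c) (hTm c) - koop (T c⁻¹) (hTm c⁻¹) with hW
  have hAV : ∀ c, Commute A (V c) := fun c => (hAUc c).add_right (hAUc c⁻¹)
  have hAW : ∀ c, Commute A (W c) := fun c => (hAUc c).sub_right (hAUc c⁻¹)
  have hVV : ∀ c d, Commute (V c) (V d) := fun c d =>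
    ((hUU c d).add_right (hUU c d⁻¹)).add_left ((hUU c⁻¹ d).add_right (hUU c⁻¹ d⁻¹))
  have hVW : ∀ c d, Commute (V c) (W d) := fun c d =>
    ((hUU c d).sub_right (hUU c d⁻¹)).add_left ((hUU c⁻¹ d).sub_right (hUU c⁻¹ d⁻¹))
  have hWW : ∀ c d, Commute (W c) (W d) := fun c d =>
    ((hUU c d).sub_right (hUU c d⁻¹)).sub_left ((hUU c⁻¹ d).sub_right (hUU c⁻¹ d⁻¹))
  have hF1 : ∀ c, jointFamily hTm A (some (c, true)) = A * V c := fun c => rfl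
  have hF2 : ∀ c, jointFamily hTm A (some (c, false)) = Complex.I • (A * W c) := fun c => rfl
  have hF0 : jointFamily hTm A none = A := rfl
  -- products
  have hP : ∀ {Y Z : Lp ℂ 2 μ →L[ℂ] Lp ℂ 2 μ}, Commute A Y → Commute A Z → Commute Y Z →
      Commute (A * Y) (A * Z) := fun hY hZ hYZ =>
    Commute.mul_right (Commute.mul_left (Commute.refl A) hY.symm) (Commute.mul_left hZ hYZ)
  have hP0 : ∀ {Y : Lp ℂ 2 μ →L[ℂ] Lp ℂ 2 μ}, Commute A Y → Commute A (A * Y) := fun hY =>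
    Commute.mul_right (Commute.refl A) hY
  rcases i with _ | ⟨c, _ | _⟩ <;> rcases j with _ | ⟨d, _ | _⟩
  · exact Commute.refl A
  · rw [hF0, hF2]; exact (hP0 (hAW d)).smul_right _
  · rw [hF0, hF1]; exact hP0 (hAV d)
  · rw [hF2, hF0]; exact ((hP0 (hAW c)).smul_right _).symm
  · rw [hF2, hF2]; exact ((hP (hAW c) (hAW d) (hWW c d)).smul_right _).smul_left _
  · rw [hF2, hF1]; exact (hP (hAW c) (hAV d) (hVW d c).symm).smul_left _
  · rw [hF1, hF0]; exact (hP0 (hAV c)).symm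
  · rw [hF1, hF2]; exact (hP (hAV c) (hAW d) (hVW c d)).smul_right _
  · rw [hF1, hF1]; exact hP (hAV c) (hAV d) (hVV c d)

include hT1 hTmul hcomm hAsa hAc hAU in
/-- **Joint eigenbasis.**  A Hilbert basis of eigenvectors of `A` (real eigenvalues in `[0, ‖A‖]` under positivity)
on which each twist `U_c` acts, wherever `λᵢ ≠ 0`, by the scalar `χᵢ(c) = ⟪bᵢ, U_c bᵢ⟫`, a unit multiplicative character. -/
theorem exists_jointEigenbasis (hpos : ∀ φ : Lp ℂ 2 μ, 0 ≤ (⟪φ, A φ⟫_ℂ).re) :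
    ∃ (s : Set (Lp ℂ 2 μ)) (b : HilbertBasis s ℂ (Lp ℂ 2 μ)) (lam : s → ℝ) (χ : s → Γ → ℂ),
      (∀ i, (b i : Lp ℂ 2 μ) = i) ∧ (∀ i, A (b i) = (lam i : ℂ) • b i) ∧ (∀ i, 0 ≤ lam i ∧ lam i ≤ ‖A‖) ∧
      (∀ i a a', χ i (a * a') = χ i a * χ i a') ∧ (∀ i a, ‖χ i a‖ = 1) ∧
      (∀ i c, lam i ≠ 0 → koop (T c) (hTm c) (b i) = χ i c • b i) ∧
      (∀ i c, lam i ≠ 0 → χ i c = ⟪(b i : Lp ℂ 2 μ), koop (T c) (hTm c) (b i)⟫_ℂ) := by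
  classical
  set F := jointFamily hTm A with hFdef
  obtain ⟨s, hon, hsp, hjoint⟩ := JointSpectral.exists_orthonormal_dense_jointEigenvectors F
    (isSelfAdjoint_jointFamily hTm hT1 hTmul hAsa hAU) (isCompactOperator_jointFamily hTm hAc)
    (commute_jointFamily hTm hTmul hcomm hAU)
  have hsp' : ⊤ ≤ (Submodule.span ℂ (Set.range ((↑) : s → Lp ℂ 2 μ))).topologicalClosure := by
    rwa [Subtype.range_coe]
  set b : HilbertBasis s ℂ (Lp ℂ 2 μ) := HilbertBasis.mk hon hsp' with hbdef
  have hb : ∀ i : s, (b i : Lp ℂ 2 μ) = i := fun i => by rw [hbdef, HilbertBasis.coe_mk]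
  -- joint eigenvalue patterns
  have hev : ∀ i : s, ∃ α : Option (Γ × Bool) → ℂ, ∀ j, F j i = α j • (i : Lp ℂ 2 μ) := fun i => by
    obtain ⟨α, hα⟩ := hjoint i i.2
    exact ⟨α, (JointSpectral.mem_jointEigenspace_iff F).mp hα⟩
  choose α hα using hev
  have hnorm1 : ∀ i : s, ‖(i : Lp ℂ 2 μ)‖ = 1 := fun i => hon.1 i
  have hinner1 : ∀ i : s, ⟪(i : Lp ℂ 2 μ), (i : Lp ℂ 2 μ)⟫_ℂ = 1 := fun i => by
    rw [inner_self_eq_norm_sq_to_K, hnorm1]; simp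
  -- the `A`-eigenvalue is `⟪i, A i⟫`, real and non-negative
  have hAi : ∀ i : s, A i = α i none • (i : Lp ℂ 2 μ) := fun i => hα i none
  have hαre : ∀ i : s, α i none = ((⟪(i : Lp ℂ 2 μ), A i⟫_ℂ).re : ℂ) := fun i => by
    have h1 : ⟪(i : Lp ℂ 2 μ), A i⟫_ℂ = α i none := by rw [hAi, inner_smul_right, hinner1, mul_one]
    have h2 : ((⟪(i : Lp ℂ 2 μ), A i⟫_ℂ).re : ℂ) = ⟪(i : Lp ℂ 2 μ), A i⟫_ℂ := by
      apply Complex.conj_eq_iff_re.mp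
      rw [inner_conj_symm]
      simpa using hAsa.isSymmetric (i : Lp ℂ 2 μ) (i : Lp ℂ 2 μ)
    rw [← h1, h2]
  set lam : s → ℝ := fun i => (⟪(i : Lp ℂ 2 μ), A i⟫_ℂ).re with hlamdef
  have hlam : ∀ i, A (b i) = (lam i : ℂ) • b i := fun i => by rw [hb, hAi, hαre]
  have hlam0 : ∀ i, 0 ≤ lam i := fun i => hpos _
  have hlamle : ∀ i, lam i ≤ ‖A‖ := fun i => by
    have h := norm_eigval_le_opNorm (b := b) (fun i => hlam i) i
    rw [Complex.norm_real, Real.norm_eq_abs] at h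
    exact (le_abs_self _).trans h
  -- where `λᵢ ≠ 0`, `U_c bᵢ = ⟪bᵢ, U_c bᵢ⟫ bᵢ`
  have hUeig : ∀ i : s, ∀ c, lam i ≠ 0 →
      koop (T c) (hTm c) (i : Lp ℂ 2 μ) = ⟪(i : Lp ℂ 2 μ), koop (T c) (hTm c) i⟫_ℂ • (i : Lp ℂ 2 μ) := by
    intro i c hli
    set Uc := koop (T c) (hTm c) with hUc
    set Ui := koop (T c⁻¹) (hTm c⁻¹) with hUi
    have e1 : A (Uc i) + A (Ui i) = α i (some (c, true)) • (i : Lp ℂ 2 μ) := by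
      have h := hα i (some (c, true))
      simp only [hFdef, jointFamily, mul_apply_eq_comp, add_apply, map_add] at h
      exact h
    have e2 : Complex.I • (A (Uc i) - A (Ui i)) = α i (some (c, false)) • (i : Lp ℂ 2 μ) := by
      have h := hα i (some (c, false))
      simp only [hFdef, jointFamily, smul_apply, mul_apply_eq_comp, sub_apply, map_sub] at h
      exact h
    -- solve for `A (U_c i)`
    have e3' : (2 : ℂ) • A (Uc i) =
        (α i (some (c, true)) - Complex.I * α i (some (c, false))) • (i : Lp ℂ 2 μ) := by
      have hII : -Complex.I * Complex.I = 1 := by rw [neg_mul, Complex.I_mul_I, neg_neg]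
      calc (2 : ℂ) • A (Uc i)
          = (A (Uc i) + A (Ui i)) + (-Complex.I) • (Complex.I • (A (Uc i) - A (Ui i))) := by
            rw [smul_smul, hII, one_smul, two_smul]; abel
        _ = α i (some (c, true)) • (i : Lp ℂ 2 μ) + (-Complex.I) • (α i (some (c, false)) • (i : Lp ℂ 2 μ)) := by
            rw [e1, e2]
        _ = (α i (some (c, true)) - Complex.I * α i (some (c, false))) • (i : Lp ℂ 2 μ) := by
            rw [smul_smul, ← add_smul]; congr 1; ring
    have e3 : A (Uc i) = ((α i (some (c, true)) - Complex.I * α i (some (c, false))) / 2) • (i : Lp ℂ 2 μ) := by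
      have h := congrArg (fun v : Lp ℂ 2 μ => (2 : ℂ)⁻¹ • v) e3'
      simp only [smul_smul, inv_mul_cancel₀ (two_ne_zero' ℂ), one_smul] at h
      rw [h, div_eq_inv_mul]
    -- and `A (U_c i) = U_c (A i) = λᵢ U_c i`
    have e4 : A (Uc i) = (lam i : ℂ) • Uc i := by
      have h := congrArg (fun f : Lp ℂ 2 μ →L[ℂ] Lp ℂ 2 μ => f i) (hAU c)
      simp only [mul_apply_eq_comp] at h
      rw [h, ← hb i, hlam i, map_smul]
    have e5 : Uc i = ((lam i : ℂ)⁻¹ * ((α i (some (c, true)) - Complex.I * α i (some (c, false))) / 2)) •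
        (i : Lp ℂ 2 μ) := by
      rw [← smul_smul, ← e3, e4, smul_smul, inv_mul_cancel₀ (Complex.ofReal_ne_zero.mpr hli), one_smul]
    have e6 : ⟪(i : Lp ℂ 2 μ), Uc i⟫_ℂ =
        (lam i : ℂ)⁻¹ * ((α i (some (c, true)) - Complex.I * α i (some (c, false))) / 2) := by
      rw [e5, inner_smul_right, hinner1, mul_one]
    rw [e6]; exact e5
  set χ : s → Γ → ℂ := fun i c => if lam i = 0 then 1 else ⟪(i : Lp ℂ 2 μ), koop (T c) (hTm c) i⟫_ℂ with hχdef
  have hχ_of_ne : ∀ i c, lam i ≠ 0 → χ i c = ⟪(i : Lp ℂ 2 μ), koop (T c) (hTm c) i⟫_ℂ := fun i c h => by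
    simp only [hχdef, if_neg h]
  have hUχ : ∀ i c, lam i ≠ 0 → koop (T c) (hTm c) (b i) = χ i c • b i := fun i c h => by
    rw [hχ_of_ne i c h, hb]; exact hUeig i c h
  have hχmul : ∀ i a a', χ i (a * a') = χ i a * χ i a' := by
    intro i a a'
    by_cases h : lam i = 0
    · simp only [hχdef, if_pos h, mul_one]
    · rw [hχ_of_ne i _ h, ← hb i, ← koop_mul_koop hTm hTmul a' a, mul_apply_eq_comp, hUχ i a h,
        map_smul, hUχ i a' h, smul_smul, inner_smul_right, hb i, hinner1, mul_one]
  have hχnorm : ∀ i a, ‖χ i a‖ = 1 := by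
    intro i a
    by_cases h : lam i = 0
    · simp only [hχdef, if_pos h, norm_one]
    · have h1 : ‖koop (T a) (hTm a) (b i)‖ = 1 := by rw [norm_koop_apply, hb, hnorm1]
      rw [hUχ i a h, norm_smul, hb, hnorm1, mul_one] at h1
      exact h1
  refine ⟨s, b, lam, χ, hb, hlam, fun i => ⟨hlam0 i, hlamle i⟩, hχmul, hχnorm, hUχ, fun i c h => ?_⟩
  rw [hχ_of_ne i c h, hb]

end Joint


/-! ## §4 The weightless twisted trace formula `Σᵢ χᵢ(c) λᵢ^{M+2} = ∫ (κ^{[M+1]} K(·, x))(T_c x) dμ(x)`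

Complex port of the tree's REAL `hasSum_pow_integral_iterate_twisted` (`TwistedKernelTraceFormula.lean`) on the
template of `hasSum_pow_integral_obs_iterate_diag_rclike`: for a measure-preserving `T` acting on the joint eigenbasis by
`U_T bᵢ = χᵢ bᵢ` wherever `λᵢ ≠ 0`, the twisted coefficient `∫ (κbᵢ)(T x) conj((κbᵢ)(x)) dμ = λᵢ² ⟪bᵢ, U_T bᵢ⟫ = λᵢ² χᵢ`
carries the factor `λᵢ²`, so the kernel of `A` (where no character is defined) drops out by itself. -/

section Trace

variable [IsFiniteMeasure μ] {K : X → X → ℂ} {C : ℝ} {A : Lp ℂ 2 μ →L[ℂ] Lp ℂ 2 μ} {ι : Type*}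
  {b : HilbertBasis ι ℂ (Lp ℂ 2 μ)} {lam : ι → ℝ}

omit [IsFiniteMeasure μ] in
/-- The twisted coefficient: `∫ (κbᵢ)(T x) · conj (κbᵢ)(x) dμ(x) = λᵢ² ⟪bᵢ, U_T bᵢ⟫`. -/
theorem integral_twisted_coeff_eq (hA : ∀ φ : Lp ℂ 2 μ, (A φ : X → ℂ) =ᵐ[μ] fun x => ∫ y, K x y * φ y ∂μ)
    (hb : ∀ i, A (b i) = (lam i : ℂ) • b i) {T : X → X} (hT : MeasurePreserving T μ μ) (i : ι) :
    ∫ x, (∫ z, K (T x) z * b i z ∂μ) * conj (∫ z, K x z * b i z ∂μ) ∂μ =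
      (lam i : ℂ) ^ 2 * ⟪(b i : Lp ℂ 2 μ), koop T hT (b i)⟫_ℂ := by
  have h1 := integral_kernel_mul_basis_ae_eq hA hb i
  have h2 : (fun x => ∫ z, K (T x) z * b i z ∂μ) =ᵐ[μ] fun x => (lam i : ℂ) * b i (T x) := ae_eq_comp_mp hT h1
  have h3 : ⟪(b i : Lp ℂ 2 μ), koop T hT (b i)⟫_ℂ = ∫ x, conj ((b i : Lp ℂ 2 μ) x) * (b i : Lp ℂ 2 μ) (T x) ∂μ := by
    rw [L2.inner_def]
    refine integral_congr_ae ?_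
    filter_upwards [coeFn_koop hT (b i : Lp ℂ 2 μ)] with x hx
    rw [RCLike.inner_apply', hx]
  rw [h3, ← integral_const_mul]
  refine integral_congr_ae ?_
  filter_upwards [h1, h2] with x hx1 hx2
  rw [hx1, hx2, map_mul, Complex.conj_ofReal]
  ring

/-- **Weightless twisted trace formula.**  `Σᵢ χᵢ λᵢ^{M+2} = ∫ (κ^{[M+1]} K(·, x))(T x) dμ(x)` for a bounded Hermitian
kernel, a countable Hilbert basis of eigenvectors `A bᵢ = λᵢ bᵢ` and a measure-preserving `T` with `U_T bᵢ = χᵢ bᵢ`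
wherever `λᵢ ≠ 0`. -/
theorem hasSum_chi_pow_integral_iterate_twisted [Countable ι] (hK : StronglyMeasurable (uncurry K))
    (hC : ∀ x y, ‖K x y‖ ≤ C) (hherm : ∀ x y, K x y = conj (K y x))
    (hA : ∀ φ : Lp ℂ 2 μ, (A φ : X → ℂ) =ᵐ[μ] fun x => ∫ y, K x y * φ y ∂μ)
    (hb : ∀ i, A (b i) = (lam i : ℂ) • b i) {T : X → X} (hT : MeasurePreserving T μ μ) {χ : ι → ℂ}
    (hχ : ∀ i, lam i ≠ 0 → koop T hT (b i) = χ i • b i) (M : ℕ) :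
    HasSum (fun i => χ i * (lam i : ℂ) ^ (M + 2))
      (∫ x, ((fun f : X → ℂ => fun w => ∫ z, K w z * f z ∂μ)^[M + 1] (fun z => K z x)) (T x) ∂μ) := by
  set cf : ι → X → ℂ := fun i x => ∫ z, K x z * b i z ∂μ with hcf
  set F : ι → X → ℂ := fun i x => (lam i : ℂ) ^ M * (cf i (T x) * conj (cf i x)) with hF
  set bd : ι → X → ℝ := fun i x => ‖A‖ ^ M * ((‖cf i (T x)‖ ^ 2 + ‖cf i x‖ ^ 2) / 2) with hbd
  have hTm : Measurable T := hT.measurable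
  have hcfm : ∀ i, Measurable (cf i) := fun i => (stronglyMeasurable_integral_kernel_mul hK (b i)).measurable
  have hFm : ∀ i, Measurable (F i) := fun i =>
    (((hcfm i).comp hTm).mul (RCLike.continuous_conj.measurable.comp (hcfm i))).const_mul _
  have hlamA : ∀ i, ‖(lam i : ℂ)‖ ≤ ‖A‖ := norm_eigval_le_opNorm hb
  -- (0) pointwise expansion at the pair `(T x, x)`
  have hpt : ∀ x, HasSum (fun i => F i x)
      (((fun f : X → ℂ => fun w => ∫ z, K w z * f z ∂μ)^[M + 1] (fun z => K z x)) (T x)) := fun x => by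
    rw [iterate_kernel_eq_inner_rclike hK hC hherm hA M x (T x)]
    exact hasSum_inner_conj_section_pow hK hC hherm hA hb M x (T x)
  -- (1) domination
  have hbound : ∀ i x, ‖F i x‖ ≤ bd i x := fun i x => by
    simp only [hF, hbd]
    rw [norm_mul, norm_mul, norm_pow, RCLike.norm_conj]
    have h2 : ‖(lam i : ℂ)‖ ^ M ≤ ‖A‖ ^ M := pow_le_pow_left₀ (norm_nonneg _) (hlamA i) M
    have h3 : ‖cf i (T x)‖ * ‖cf i x‖ ≤ (‖cf i (T x)‖ ^ 2 + ‖cf i x‖ ^ 2) / 2 := by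
      nlinarith [sq_nonneg (‖cf i (T x)‖ - ‖cf i x‖), norm_nonneg (cf i (T x)), norm_nonneg (cf i x)]
    exact mul_le_mul h2 h3 (by positivity) (by positivity)
  have hpars : ∀ x, Summable (fun i => ‖cf i x‖ ^ 2) ∧ ∑' i, ‖cf i x‖ ^ 2 = ∫ z, ‖K x z‖ ^ 2 ∂μ ∧
      ∫ z, ‖K x z‖ ^ 2 ∂μ ≤ C ^ 2 * μ.real Set.univ := fun x => tsum_norm_sq_integral_kernel_mul_le hK hC b x
  have hbd_sum : ∀ x, Summable fun i => bd i x := fun x =>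
    (((hpars (T x)).1.add (hpars x).1).div_const 2).mul_left _
  have hsq_meas : Measurable fun x => ∫ z, ‖K x z‖ ^ 2 ∂μ :=
    (stronglyMeasurable_integral_norm_kernel_sq hK).measurable
  have hbd_int : Integrable (fun x => ∑' i, bd i x) μ := by
    have hfun : (fun x => ∑' i, bd i x) =
        fun x => ‖A‖ ^ M * ((∫ z, ‖K (T x) z‖ ^ 2 ∂μ + ∫ z, ‖K x z‖ ^ 2 ∂μ) / 2) := by
      funext x
      simp only [hbd]
      rw [tsum_mul_left, tsum_div_const, (hpars (T x)).1.tsum_add (hpars x).1, (hpars (T x)).2.1, (hpars x).2.1]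
    rw [hfun]
    have hbdd : ∀ y, ‖∫ z, ‖K y z‖ ^ 2 ∂μ‖ ≤ C ^ 2 * μ.real Set.univ := fun y => by
      rw [Real.norm_eq_abs, abs_of_nonneg (integral_nonneg fun z => by positivity)]
      exact (hpars y).2.2
    exact (((Integrable.of_bound (hsq_meas.comp hTm).aestronglyMeasurable (C ^ 2 * μ.real Set.univ)
        (Eventually.of_forall fun x => hbdd (T x))).add
      (Integrable.of_bound hsq_meas.aestronglyMeasurable (C ^ 2 * μ.real Set.univ)
        (Eventually.of_forall fun x => hbdd x))).div_const 2).const_mul _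
  have key := hasSum_integral_of_dominated_convergence (μ := μ) bd
    (fun i => (hFm i).aestronglyMeasurable) (fun i => Eventually.of_forall (hbound i))
    (Eventually.of_forall hbd_sum) hbd_int (Eventually.of_forall hpt)
  -- (2) the terms
  have hterm : ∀ i, ∫ x, F i x ∂μ = χ i * (lam i : ℂ) ^ (M + 2) := by
    intro i
    have h1 : ∫ x, F i x ∂μ = (lam i : ℂ) ^ (M + 2) * ⟪(b i : Lp ℂ 2 μ), koop T hT (b i)⟫_ℂ := by
      simp only [hF, hcf]
      rw [integral_const_mul, integral_twisted_coeff_eq hA hb hT i, ← mul_assoc, ← pow_add]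
    rw [h1]
    by_cases h0 : lam i = 0
    · rw [h0]; simp
    · rw [hχ i h0, inner_smul_right, inner_self_eq_norm_sq_to_K, b.orthonormal.norm_eq_one i]; simp [mul_comm]
  exact key.congr_fun fun i => (hterm i).symm

end Trace

/-! ## §5 The growth rate of the traces is the top eigenvalue -/

section Growth

/-- Complex version of the tree's `exists_index_eq_norm`: an eigenvector for the eigenvalue `‖T‖` of a self-adjoint
`T` with a Hilbert basis of eigenvectors forces `‖T‖ = λᵢ` for some `i`. -/
theorem exists_index_eq_norm_complex {E : Type*} [NormedAddCommGroup E] [InnerProductSpace ℂ E] [CompleteSpace E]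
    {ι : Type*} (b : HilbertBasis ι ℂ E) {T : E →L[ℂ] E} (hT : IsSelfAdjoint T) {lam : ι → ℝ}
    (hb : ∀ i, T (b i) = (lam i : ℂ) • b i) {ψ : E} (hψ0 : ψ ≠ 0) (hψ : T ψ = ((‖T‖ : ℝ) : ℂ) • ψ) :
    ∃ i, lam i = ‖T‖ := by
  by_contra h
  push Not at h
  have hcoef : ∀ i, ⟪b i, ψ⟫_ℂ = 0 := fun i => by
    have h1 : ⟪b i, T ψ⟫_ℂ = ((‖T‖ : ℝ) : ℂ) * ⟪b i, ψ⟫_ℂ := by rw [hψ, inner_smul_right]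
    have h2 : ⟪b i, T ψ⟫_ℂ = ((lam i : ℝ) : ℂ) * ⟪b i, ψ⟫_ℂ := by
      have hs := hT.isSymmetric (b i) ψ
      simp only [ContinuousLinearMap.coe_coe] at hs
      rw [← hs, hb, inner_smul_left, Complex.conj_ofReal]
    have h3 : (((lam i : ℝ) : ℂ) - ((‖T‖ : ℝ) : ℂ)) * ⟪b i, ψ⟫_ℂ = 0 := by rw [sub_mul, ← h2, ← h1, sub_self]
    refine (mul_eq_zero.1 h3).resolve_left ?_
    intro h4
    exact h i (Complex.ofReal_inj.mp (sub_eq_zero.mp h4))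
  apply hψ0
  have hr : b.repr ψ = 0 := lp.ext (funext fun i => by simp [HilbertBasis.repr_apply_apply, hcoef i])
  exact b.repr.injective (by rw [hr, map_zero])

/-- **Growth rate = top of the spectrum.**  If `Z (n+1) = Σᵢ λᵢ^{n+2}` for all `n` where `A bᵢ = λᵢ bᵢ` is a Hilbert
eigenbasis of a compact self-adjoint `A` with `0 ≤ Re ⟪φ, Aφ⟫` and `0 ≤ λᵢ`, then
`limsup_m Z(m)^{1/(m+1)} = ‖A‖` — also when `A = 0` (then `Z (n+1) = 0`). -/
theorem limsup_rpow_eq_norm {E : Type*} [NormedAddCommGroup E] [InnerProductSpace ℂ E] [CompleteSpace E]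
    {ι : Type*} (b : HilbertBasis ι ℂ E) {A : E →L[ℂ] E} (hAsa : IsSelfAdjoint A) (hAc : IsCompactOperator A)
    (hpos : ∀ φ : E, 0 ≤ RCLike.re ⟪φ, A φ⟫_ℂ) {lam : ι → ℝ} (hb : ∀ i, A (b i) = (lam i : ℂ) • b i)
    (hlam0 : ∀ i, 0 ≤ lam i) {Z : ℕ → ℝ} (hZ : ∀ n, HasSum (fun i => lam i ^ (n + 2)) (Z (n + 1))) :
    limsup (fun m : ℕ => Z m ^ (((m : ℝ) + 1)⁻¹)) atTop = ‖A‖ := by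
  have hlamle : ∀ i, lam i ≤ ‖A‖ := fun i => by
    have h1 : ‖A (b i)‖ = ‖(lam i : ℂ)‖ := by rw [hb, norm_smul, b.orthonormal.norm_eq_one i, mul_one]
    have h2 : ‖A (b i)‖ ≤ ‖A‖ := by
      calc ‖A (b i)‖ ≤ ‖A‖ * ‖b i‖ := A.le_opNorm _
        _ = ‖A‖ := by rw [b.orthonormal.norm_eq_one i, mul_one]
    rw [h1, Complex.norm_real, Real.norm_eq_abs] at h2
    exact (le_abs_self _).trans h2
  by_cases hA0 : A = 0
  · -- all eigenvalues vanish, `Z (n+1) = 0`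
    have hl0 : ∀ i, lam i = 0 := fun i => le_antisymm (by simpa [hA0] using hlamle i) (hlam0 i)
    have hZ0 : ∀ n, Z (n + 1) = 0 := fun n => by
      have h := hZ n
      have h' : HasSum (fun _ : ι => (0 : ℝ)) (Z (n + 1)) :=
        h.congr_fun fun i => by rw [hl0 i, zero_pow (by omega)]
      exact h'.unique hasSum_zero
    have hev : (fun m : ℕ => Z m ^ (((m : ℝ) + 1)⁻¹)) =ᶠ[atTop] fun _ => (0 : ℝ) := by
      filter_upwards [Filter.eventually_ge_atTop 1] with m hm
      obtain ⟨n, rfl⟩ := Nat.exists_eq_add_of_le' hm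
      rw [hZ0 n, Real.zero_rpow (inv_ne_zero (by positivity))]
    rw [Filter.limsup_congr hev, Filter.limsup_const, hA0, norm_zero]
  · -- an eigenvector for `‖A‖` exists; it is one of the `bᵢ`
    have hnt : Nontrivial E := by
      by_contra hE
      have : Subsingleton E := not_nontrivial_iff_subsingleton.mp hE
      exact hA0 (Subsingleton.elim _ _)
    obtain ⟨Ω, hΩ1, hΩ⟩ := exists_eigenvector_norm_of_re_inner_nonneg hAsa hAc hpos
    have hΩ0 : Ω ≠ 0 := by
      intro h; rw [h, norm_zero] at hΩ1; exact zero_ne_one hΩ1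
    obtain ⟨i₀, hi₀⟩ := exists_index_eq_norm_complex b hAsa hb hΩ0 hΩ
    have hL0 : 0 < lam i₀ := by rw [hi₀]; exact norm_pos_iff.mpr hA0
    rw [← hi₀]
    exact limsup_rpow_eq_of_hasSum_pow hlam0 (fun i => (hlamle i).trans_eq hi₀.symm) hL0 (hZ 0).summable hZ

end Growth


/-! ## §6  Kernel calculus on `L²(X, μ; ℂ)`

Compositions of bounded-kernel operators have the composed kernel (Fubini); the Koopman twist of a kernel
operator has the twisted kernel; the iterates of the operator of a REAL kernel `K` have the tree's path kernels
(`PathKernelDomination`, probability measure) as kernels; and a real kernel `B_k` dominated pointwise by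
`nrm · P_r` has diagonal matrix coefficients `|⟪φ, B φ⟫| ≤ nrm ‖𝔸‖^{r+1} ‖φ‖²` (the species-norm clause of
`SpectralDictOn`, via the modulus `|φ| ∈ L²`; no real/complex operator comparison is needed). -/

section KernelCalc

omit [MeasurableSpace X] in
private theorem nonneg_of_norm_le {K : X → X → ℂ} {C : ℝ} (hC : ∀ x y, ‖K x y‖ ≤ C) (x : X) : 0 ≤ C :=
  (norm_nonneg _).trans (hC x x)

/-- **Composition of kernel operators**: if `A₁ φ =ᵐ ∫ K₁(·, y) φ(y)` and `A₂ φ =ᵐ ∫ K₂(·, y) φ(y)` with bounded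
strongly measurable kernels on a finite measure space, then `(A₁ ∘ A₂) φ =ᵐ ∫ (∫ K₁(·, u) K₂(u, y) dμ(u)) φ(y) dμ(y)`
(Fubini; `L² ⊆ L¹`). [folklore] -/
theorem comp_ae_kernel [IsFiniteMeasure μ] {K₁ K₂ : X → X → ℂ} {C₁ C₂ : ℝ} {A₁ A₂ : Lp ℂ 2 μ →L[ℂ] Lp ℂ 2 μ}
    (hK₁ : StronglyMeasurable (uncurry K₁)) (hK₂ : StronglyMeasurable (uncurry K₂))
    (hC₁ : ∀ x y, ‖K₁ x y‖ ≤ C₁) (hC₂ : ∀ x y, ‖K₂ x y‖ ≤ C₂)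
    (hA₁ : ∀ φ : Lp ℂ 2 μ, (A₁ φ : X → ℂ) =ᵐ[μ] fun x => ∫ y, K₁ x y * φ y ∂μ)
    (hA₂ : ∀ φ : Lp ℂ 2 μ, (A₂ φ : X → ℂ) =ᵐ[μ] fun x => ∫ y, K₂ x y * φ y ∂μ) (φ : Lp ℂ 2 μ) :
    ((A₁.comp A₂) φ : X → ℂ) =ᵐ[μ] fun x => ∫ y, (∫ u, K₁ x u * K₂ u y ∂μ) * φ y ∂μ := by
  rw [ContinuousLinearMap.comp_apply]
  filter_upwards [hA₁ (A₂ φ)] with x hx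
  rw [hx]
  have h0C₁ : 0 ≤ C₁ := nonneg_of_norm_le hC₁ x
  have hφ : Integrable (fun y => (φ : X → ℂ) y) μ := (Lp.memLp φ).integrable one_le_two
  have h1 : ∫ u, K₁ x u * (A₂ φ : X → ℂ) u ∂μ = ∫ u, ∫ y, K₁ x u * (K₂ u y * φ y) ∂μ ∂μ := by
    refine integral_congr_ae ?_
    filter_upwards [hA₂ φ] with u hu
    rw [hu, ← integral_const_mul]
  rw [h1]
  have hint : Integrable (uncurry fun u y => K₁ x u * (K₂ u y * φ y)) (μ.prod μ) := by
    have h2 : Integrable (fun z : X × X => (1 : ℂ) * (φ : X → ℂ) z.2) (μ.prod μ) :=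
      (integrable_const (1 : ℂ)).mul_prod hφ
    have h3 : Integrable (fun z : X × X => (K₁ x z.1 * K₂ z.1 z.2) * ((1 : ℂ) * (φ : X → ℂ) z.2))
        (μ.prod μ) := by
      refine h2.bdd_mul (c := C₁ * C₂) ?_ (Eventually.of_forall fun z => ?_)
      · exact (((hK₁.of_uncurry_left (x := x)).comp_measurable measurable_fst).mul hK₂).aestronglyMeasurable
      · rw [norm_mul]
        exact mul_le_mul (hC₁ _ _) (hC₂ _ _) (norm_nonneg _) h0C₁
    refine h3.congr (Eventually.of_forall fun z => ?_)
    simp only [uncurry, one_mul]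
    ring
  rw [integral_integral_swap hint]
  refine integral_congr_ae (Eventually.of_forall fun y => ?_)
  dsimp only
  rw [← integral_mul_const]
  refine integral_congr_ae (Eventually.of_forall fun u => ?_)
  dsimp only
  ring

/-- **Koopman twist of a kernel operator**: `(U_T ∘ A) φ =ᵐ ∫ K(T ·, y) φ(y) dμ(y)`. [folklore] -/
theorem koop_comp_ae_kernel {K : X → X → ℂ} {A : Lp ℂ 2 μ →L[ℂ] Lp ℂ 2 μ}
    (hA : ∀ φ : Lp ℂ 2 μ, (A φ : X → ℂ) =ᵐ[μ] fun x => ∫ y, K x y * φ y ∂μ) {T : X → X}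
    (hT : MeasurePreserving T μ μ) (φ : Lp ℂ 2 μ) :
    (((koop T hT).comp A) φ : X → ℂ) =ᵐ[μ] fun x => ∫ y, K (T x) y * φ y ∂μ := by
  rw [ContinuousLinearMap.comp_apply]
  exact (coeFn_koop hT (A φ)).trans (ae_eq_comp_mp hT (hA φ))

/-- The composed kernel `(x, y) ↦ ∫ K₁(x, u) K₂(u, y) dμ(u)` is jointly strongly measurable. [folklore] -/
theorem stronglyMeasurable_compKernel [SFinite μ] {K₁ K₂ : X → X → ℂ} (hK₁ : StronglyMeasurable (uncurry K₁))
    (hK₂ : StronglyMeasurable (uncurry K₂)) :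
    StronglyMeasurable (uncurry fun x y => ∫ u, K₁ x u * K₂ u y ∂μ) := by
  have h : StronglyMeasurable (uncurry fun (p : X × X) (u : X) => K₁ p.1 u * K₂ u p.2) :=
    (hK₁.comp_measurable (measurable_fst.fst.prodMk measurable_snd)).mul
      (hK₂.comp_measurable (measurable_snd.prodMk measurable_fst.snd))
  exact h.integral_prod_right'

/-- The composed kernel is bounded by `C₁ C₂ μ(X)`. [folklore] -/
theorem norm_compKernel_le [IsFiniteMeasure μ] {K₁ K₂ : X → X → ℂ} {C₁ C₂ : ℝ} (hC₁ : ∀ x y, ‖K₁ x y‖ ≤ C₁)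
    (hC₂ : ∀ x y, ‖K₂ x y‖ ≤ C₂) (x y : X) :
    ‖∫ u, K₁ x u * K₂ u y ∂μ‖ ≤ C₁ * C₂ * μ.real Set.univ :=
  norm_integral_le_of_norm_le_const (Eventually.of_forall fun u => by
    rw [norm_mul]; exact mul_le_mul (hC₁ _ _) (hC₂ _ _) (norm_nonneg _) (nonneg_of_norm_le hC₁ x))

/-- The twisted kernel `(x, y) ↦ K(T x, y)` is jointly strongly measurable. [folklore] -/
theorem stronglyMeasurable_twistKernel {K : X → X → ℂ} (hK : StronglyMeasurable (uncurry K)) {T : X → X}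
    (hT : Measurable T) : StronglyMeasurable (uncurry fun x y => K (T x) y) :=
  hK.comp_measurable ((hT.comp measurable_fst).prodMk measurable_snd)

/-! ### Path kernels of a real kernel (the tree's `PathKernelDomination`, named) -/

/-- The `(r+1)`-step path kernel `P_r(u, y) = ∫ K(u, v₁) K(v₁, v₂) ⋯ K(v_r, y) dμ^{⊗r}(v)` of a real kernel
(the expression of `Literature.Analysis.OperatorTheory.PathKernelDomination`, given a name). [folklore] -/
def pathK (μ : Measure X) (K : X → X → ℝ) (r : ℕ) (u y : X) : ℝ :=
  ∫ v : Fin r → X, ∏ i : Fin (r + 1), K ((Fin.cons u (Fin.snoc v y) : Fin (r + 2) → X) (Fin.castSucc i))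
    ((Fin.cons u (Fin.snoc v y) : Fin (r + 2) → X) (Fin.succ i)) ∂(Measure.pi fun _ => μ)

section PathK

variable [IsProbabilityMeasure μ] {K : X → X → ℝ} {C : ℝ}

theorem pathK_zero (K : X → X → ℝ) (u y : X) : pathK μ K 0 u y = K u y := by
  unfold pathK
  rw [pathKernel_eq K 0 u y]
  simp [integral_const, probReal_univ]

theorem pathK_succ (hK : Measurable (uncurry K)) (hC : ∀ x y, ‖K x y‖ ≤ C) (r : ℕ) (u y : X) :
    pathK μ K (r + 1) u y = ∫ y', K u y' * pathK μ K r y' y ∂μ := by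
  unfold pathK
  exact pathKernel_succ hK hC r u y

theorem measurable_pathK (hK : Measurable (uncurry K)) (r : ℕ) : Measurable (uncurry (pathK μ K r)) :=
  measurable_pathKernel hK r

omit [IsProbabilityMeasure μ] in
theorem norm_pathK_le [IsProbabilityMeasure μ] (hC : ∀ x y, ‖K x y‖ ≤ C) (r : ℕ) (u y : X) :
    ‖pathK μ K r u y‖ ≤ C ^ (r + 1) :=
  norm_pathKernel_le hC r u y

/-- **The iterates of the operator of a real kernel have the path kernels as kernels**:
`𝔸^{r+1} φ =ᵐ ∫ P_r(·, y) φ(y) dμ(y)` on `L²(ℂ)` (induction: `pathK_succ` and `comp_ae_kernel`). [folklore] -/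
theorem pow_succ_ae_pathK {A : Lp ℂ 2 μ →L[ℂ] Lp ℂ 2 μ} (hK : StronglyMeasurable (uncurry K))
    (hC : ∀ x y, ‖K x y‖ ≤ C)
    (hA : ∀ φ : Lp ℂ 2 μ, (A φ : X → ℂ) =ᵐ[μ] fun x => ∫ y, ((K x y : ℝ) : ℂ) * φ y ∂μ) (r : ℕ)
    (φ : Lp ℂ 2 μ) :
    ((A ^ (r + 1)) φ : X → ℂ) =ᵐ[μ] fun x => ∫ y, ((pathK μ K r x y : ℝ) : ℂ) * φ y ∂μ := by
  induction r generalizing φ with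
  | zero =>
    simp_rw [zero_add, pow_one, pathK_zero]
    exact hA φ
  | succ r ih =>
    have hKc : StronglyMeasurable (uncurry fun x y => ((K x y : ℝ) : ℂ)) :=
      Complex.continuous_ofReal.comp_stronglyMeasurable hK
    have hPc : StronglyMeasurable (uncurry fun x y => ((pathK μ K r x y : ℝ) : ℂ)) :=
      Complex.continuous_ofReal.comp_stronglyMeasurable (measurable_pathK hK.measurable r).stronglyMeasurable
    have hCc : ∀ x y, ‖((K x y : ℝ) : ℂ)‖ ≤ C := fun x y => by rw [Complex.norm_real]; exact hC x y
    have hCP : ∀ x y, ‖((pathK μ K r x y : ℝ) : ℂ)‖ ≤ C ^ (r + 1) := fun x y => by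
      rw [Complex.norm_real]; exact norm_pathK_le hC r x y
    have h := comp_ae_kernel hKc hPc hCc hCP hA ih φ
    rw [pow_succ', ContinuousLinearMap.mul_def]
    refine h.trans (Eventually.of_forall fun x => ?_)
    refine integral_congr_ae (Eventually.of_forall fun y => ?_)
    dsimp only
    rw [pathK_succ hK.measurable hC r x y, ← integral_complex_ofReal]
    push_cast
    rfl

/-- **Diagonal coefficients of a dominated block.**  If `B φ =ᵐ ∫ B_k(·, y) φ(y)` with a real kernel
`|B_k(x, y)| ≤ nrm · P_r(x, y)` (`nrm ≥ 0`), then `|⟪φ, B φ⟫| ≤ nrm ‖𝔸‖^{r+1} ‖φ‖²` for every `φ ∈ L²(ℂ)`: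
`|⟪φ, Bφ⟫| ≤ ∬ |φ(x)| nrm P_r(x, y) |φ(y)| = nrm · Re ⟪|φ|, 𝔸^{r+1} |φ|⟫ ≤ nrm ‖𝔸‖^{r+1} ‖φ‖²`. [folklore] -/
theorem norm_inner_le_of_abs_le_pathK {Bk : X → X → ℝ} {CB nrm : ℝ} {A B : Lp ℂ 2 μ →L[ℂ] Lp ℂ 2 μ}
    (hK : StronglyMeasurable (uncurry K)) (hC : ∀ x y, ‖K x y‖ ≤ C)
    (hA : ∀ φ : Lp ℂ 2 μ, (A φ : X → ℂ) =ᵐ[μ] fun x => ∫ y, ((K x y : ℝ) : ℂ) * φ y ∂μ)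
    (hBk : StronglyMeasurable (uncurry Bk)) (hCB : ∀ x y, ‖Bk x y‖ ≤ CB)
    (hB : ∀ φ : Lp ℂ 2 μ, (B φ : X → ℂ) =ᵐ[μ] fun x => ∫ y, ((Bk x y : ℝ) : ℂ) * φ y ∂μ)
    (hnrm : 0 ≤ nrm) {r : ℕ} (hdom : ∀ x y, |Bk x y| ≤ nrm * pathK μ K r x y) (φ : Lp ℂ 2 μ) :
    ‖⟪φ, B φ⟫_ℂ‖ ≤ nrm * ‖A‖ ^ (r + 1) * ‖φ‖ ^ 2 := by
  -- the modulus `|φ|` as an element of `L²(ℂ)`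
  have hmem : MemLp (fun x => ((‖(φ : X → ℂ) x‖ : ℝ) : ℂ)) 2 μ := (Lp.memLp φ).norm.ofReal
  set ψ : Lp ℂ 2 μ := hmem.toLp _ with hψdef
  have hψae : (ψ : X → ℂ) =ᵐ[μ] fun x => ((‖(φ : X → ℂ) x‖ : ℝ) : ℂ) := hmem.coeFn_toLp
  have hψnorm : ‖ψ‖ = ‖φ‖ := by
    have h1 : ‖ψ‖ ^ 2 = ∫ x, ‖((‖(φ : X → ℂ) x‖ : ℝ) : ℂ)‖ ^ 2 ∂μ := norm_toLp_sq_eq_integral_norm_sq hmem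
    have h2 : ‖φ‖ ^ 2 = ∫ x, ‖(φ : X → ℂ) x‖ ^ 2 ∂μ := by
      have h := norm_toLp_sq_eq_integral_norm_sq (Lp.memLp φ)
      rwa [Lp.toLp_coeFn] at h
    simp_rw [Complex.norm_real, norm_norm] at h1
    exact (pow_left_inj₀ (norm_nonneg _) (norm_nonneg _) two_ne_zero).mp (h1.trans h2.symm)
  -- integrability bookkeeping
  have hφn : Integrable (fun y => ‖(φ : X → ℂ) y‖) μ := ((Lp.memLp φ).integrable one_le_two).norm
  have hPm : Measurable (uncurry (pathK μ K r)) := measurable_pathK hK.measurable r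
  set g : X → ℝ := fun x => ∫ y, pathK μ K r x y * ‖(φ : X → ℂ) y‖ ∂μ with hgdef
  have hgm : StronglyMeasurable g :=
    (hPm.stronglyMeasurable.mul ((Lp.stronglyMeasurable φ).norm.comp_measurable measurable_snd)).integral_prod_right'
  have hgb : ∀ x, ‖g x‖ ≤ C ^ (r + 1) * ∫ y, ‖(φ : X → ℂ) y‖ ∂μ := fun x => by
    rw [hgdef, ← integral_const_mul]
    refine norm_integral_le_of_norm_le (hφn.const_mul _) (Eventually.of_forall fun y => ?_)
    rw [norm_mul, norm_norm]
    exact mul_le_mul_of_nonneg_right (norm_pathK_le hC r x y) (norm_nonneg _)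
  have hI1 : ∀ x, Integrable (fun y => ‖Bk x y‖ * ‖(φ : X → ℂ) y‖) μ := fun x =>
    hφn.bdd_mul (c := CB) (hBk.of_uncurry_left (x := x)).norm.aestronglyMeasurable
      (Eventually.of_forall fun y => by rw [norm_norm]; exact hCB x y)
  have hI2 : ∀ x, Integrable (fun y => nrm * pathK μ K r x y * ‖(φ : X → ℂ) y‖) μ := fun x =>
    hφn.bdd_mul (c := ‖nrm‖ * C ^ (r + 1))
      ((hPm.of_uncurry_left (x := x)).const_mul nrm).aestronglyMeasurable
      (Eventually.of_forall fun y => by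
        rw [norm_mul]; exact mul_le_mul_of_nonneg_left (norm_pathK_le hC r x y) (norm_nonneg _))
  have hI3 : Integrable (fun x => ‖(φ : X → ℂ) x‖ * (nrm * g x)) μ :=
    hφn.mul_bdd (c := ‖nrm‖ * (C ^ (r + 1) * ∫ y, ‖(φ : X → ℂ) y‖ ∂μ))
      (hgm.const_mul nrm).aestronglyMeasurable
      (Eventually.of_forall fun x => by rw [norm_mul]; exact mul_le_mul_of_nonneg_left (hgb x) (norm_nonneg _))
  -- Step 1: the double-integral bound
  have hstep1 : ‖⟪φ, B φ⟫_ℂ‖ ≤ nrm * ∫ x, ‖(φ : X → ℂ) x‖ * g x ∂μ := by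
    rw [inner_eq_integral_of_ae_kernel hB φ φ]
    have hpt : ∀ x, ‖conj ((φ : X → ℂ) x) * ∫ y, ((Bk x y : ℝ) : ℂ) * φ y ∂μ‖ ≤
        ‖(φ : X → ℂ) x‖ * (nrm * g x) := fun x => by
      rw [norm_mul, RCLike.norm_conj]
      refine mul_le_mul_of_nonneg_left ?_ (norm_nonneg _)
      calc ‖∫ y, ((Bk x y : ℝ) : ℂ) * φ y ∂μ‖ ≤ ∫ y, ‖Bk x y‖ * ‖(φ : X → ℂ) y‖ ∂μ :=
            norm_integral_le_of_norm_le (hI1 x) (Eventually.of_forall fun y => by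
              rw [norm_mul, Complex.norm_real])
        _ ≤ ∫ y, nrm * pathK μ K r x y * ‖(φ : X → ℂ) y‖ ∂μ :=
            integral_mono (hI1 x) (hI2 x) fun y =>
              mul_le_mul_of_nonneg_right ((Real.norm_eq_abs _).le.trans (hdom x y)) (norm_nonneg _)
        _ = nrm * g x := by
            rw [hgdef, ← integral_const_mul]
            exact integral_congr_ae (Eventually.of_forall fun y => by dsimp only; ring)
    calc _ ≤ ∫ x, ‖(φ : X → ℂ) x‖ * (nrm * g x) ∂μ := norm_integral_le_of_norm_le hI3 (Eventually.of_forall hpt)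
      _ = nrm * ∫ x, ‖(φ : X → ℂ) x‖ * g x ∂μ := by
          rw [← integral_const_mul]
          exact integral_congr_ae (Eventually.of_forall fun x => by dsimp only; ring)
  -- Step 2: the double integral is `Re ⟪|φ|, 𝔸^{r+1} |φ|⟫`
  have hstep2 : (∫ x, ‖(φ : X → ℂ) x‖ * g x ∂μ : ℝ) = (⟪ψ, (A ^ (r + 1)) ψ⟫_ℂ).re := by
    rw [inner_eq_integral_of_ae_kernel (pow_succ_ae_pathK hK hC hA r) ψ ψ]
    have h : ∫ x, conj ((ψ : X → ℂ) x) * ∫ y, ((pathK μ K r x y : ℝ) : ℂ) * ψ y ∂μ ∂μ =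
        ∫ x, (((‖(φ : X → ℂ) x‖ * g x : ℝ)) : ℂ) ∂μ := by
      refine integral_congr_ae ?_
      filter_upwards [hψae] with x hx
      rw [hx, Complex.conj_ofReal, Complex.ofReal_mul]
      congr 1
      simp only [hgdef]
      rw [← integral_complex_ofReal]
      refine integral_congr_ae ?_
      filter_upwards [hψae] with y hy
      rw [hy]
      push_cast
      ring
    rw [h, integral_complex_ofReal, Complex.ofReal_re]
  -- Step 3: Cauchy–Schwarz and the operator norm
  have hstep3 : (⟪ψ, (A ^ (r + 1)) ψ⟫_ℂ).re ≤ ‖A‖ ^ (r + 1) * ‖φ‖ ^ 2 := by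
    calc (⟪ψ, (A ^ (r + 1)) ψ⟫_ℂ).re ≤ ‖⟪ψ, (A ^ (r + 1)) ψ⟫_ℂ‖ := Complex.re_le_norm _
      _ ≤ ‖ψ‖ * ‖(A ^ (r + 1)) ψ‖ := norm_inner_le_norm _ _
      _ ≤ ‖ψ‖ * (‖A ^ (r + 1)‖ * ‖ψ‖) := by gcongr; exact (A ^ (r + 1)).le_opNorm ψ
      _ ≤ ‖ψ‖ * (‖A‖ ^ (r + 1) * ‖ψ‖) := by gcongr; exact norm_pow_le' A r.succ_pos
      _ = ‖A‖ ^ (r + 1) * ‖φ‖ ^ 2 := by rw [hψnorm]; ring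
  calc ‖⟪φ, B φ⟫_ℂ‖ ≤ nrm * ∫ x, ‖(φ : X → ℂ) x‖ * g x ∂μ := hstep1
    _ = nrm * (⟪ψ, (A ^ (r + 1)) ψ⟫_ℂ).re := by rw [hstep2]
    _ ≤ nrm * (‖A‖ ^ (r + 1) * ‖φ‖ ^ 2) := mul_le_mul_of_nonneg_left hstep3 hnrm
    _ = nrm * ‖A‖ ^ (r + 1) * ‖φ‖ ^ 2 := by ring

end PathK

end KernelCalc


/-! ## §7  Positive type; the two dictionary clauses in cast form -/

section PositiveType

variable [IsFiniteMeasure μ] {K : X → X → ℂ} {A : Lp ℂ 2 μ →L[ℂ] Lp ℂ 2 μ}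

omit [IsFiniteMeasure μ] in
/-- **Positive type passes to `L²(ℂ)`.**  If `Re ∬ conj f(x) K(x,y) f(y) ≥ 0` for every measurable `‖f‖ ≤ 1`, then
`0 ≤ Re ⟪φ, Aφ⟫` for every `φ ∈ L²(ℂ)` (rescaling; density of simple functions; continuity of `φ ↦ ⟪φ, Aφ⟫`) — the
complex twin of the tree's `inner_kernelOp_self_nonneg`. [folklore] -/
theorem re_inner_kernelOp_self_nonneg
    (hA : ∀ φ : Lp ℂ 2 μ, (A φ : X → ℂ) =ᵐ[μ] fun x => ∫ y, K x y * φ y ∂μ)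
    (hpt : ∀ f : X → ℂ, Measurable f → (∀ x, ‖f x‖ ≤ 1) →
      0 ≤ (∫ x, ∫ y, conj (f x) * K x y * f y ∂μ ∂μ).re) (φ : Lp ℂ 2 μ) :
    0 ≤ (⟪φ, A φ⟫_ℂ).re := by
  have hd := Lp.simpleFunc.denseRange (E := ℂ) (p := (2 : ℝ≥0∞)) (μ := μ) ENNReal.ofNat_ne_top
  have hpt' : ∀ f : X → ℂ, Measurable f → ∀ B : ℝ, (∀ x, ‖f x‖ ≤ B) →
      0 ≤ (∫ x, ∫ y, conj (f x) * K x y * f y ∂μ ∂μ).re := by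
    intro f hf B hB
    set B' := max B 1 with hB'
    have hB'0 : 0 < B' := lt_of_lt_of_le one_pos (le_max_right _ _)
    have h := hpt (fun x => f x / (B' : ℂ)) (hf.div_const _) fun x => by
      rw [norm_div, Complex.norm_real, Real.norm_eq_abs, abs_of_pos hB'0, div_le_one hB'0]
      exact (hB x).trans (le_max_left _ _)
    have he : (∫ x, ∫ y, conj (f x / (B' : ℂ)) * K x y * (f y / (B' : ℂ)) ∂μ ∂μ) =
        (∫ x, ∫ y, conj (f x) * K x y * f y ∂μ ∂μ) / ((B' : ℂ) ^ 2) := by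
      rw [← integral_div]
      refine integral_congr_ae (Eventually.of_forall fun x => ?_)
      dsimp only
      rw [← integral_div]
      refine integral_congr_ae (Eventually.of_forall fun y => ?_)
      dsimp only
      have hB'c : (B' : ℂ) ≠ 0 := by exact_mod_cast hB'0.ne'
      rw [map_div₀, Complex.conj_ofReal]
      field_simp
    rw [he] at h
    have hB2 : ((B' : ℂ) ^ 2) = ((B' ^ 2 : ℝ) : ℂ) := by push_cast; rfl
    rw [hB2, Complex.div_ofReal_re] at h
    have h' := (le_div_iff₀ (by positivity : (0 : ℝ) < B' ^ 2)).mp h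
    simpa using h'
  refine hd.induction_on (p := fun φ => 0 ≤ (⟪φ, A φ⟫_ℂ).re) φ
    (isClosed_le continuous_const (Complex.continuous_re.comp (continuous_id.inner A.continuous))) fun φs => ?_
  set f := Lp.simpleFunc.toSimpleFunc φs with hf_def
  have hf : (f : X → ℂ) =ᵐ[μ] ((φs : Lp ℂ 2 μ) : X → ℂ) := Lp.simpleFunc.toSimpleFunc_eq_toFun φs
  obtain ⟨B, hB⟩ := f.exists_forall_norm_le
  have heq : ⟪(φs : Lp ℂ 2 μ), A (φs : Lp ℂ 2 μ)⟫_ℂ = ∫ x, ∫ y, conj (f x) * K x y * f y ∂μ ∂μ := by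
    rw [inner_eq_integral_of_ae_kernel hA]
    refine integral_congr_ae ?_
    filter_upwards [hf] with x hx
    rw [← hx, ← integral_const_mul]
    refine integral_congr_ae ?_
    filter_upwards [hf] with y hy
    rw [← hy]
    ring
  show 0 ≤ (⟪(φs : Lp ℂ 2 μ), A (φs : Lp ℂ 2 μ)⟫_ℂ).re
  rw [heq]
  exact hpt' f f.measurable B hB


/-- Sections of a bounded real kernel against bounded measurable real test functions are integrable. -/
theorem integrable_realSection {Kr : X → X → ℝ} {C : ℝ} (hK : StronglyMeasurable (uncurry Kr))
    (hC : ∀ x y, ‖Kr x y‖ ≤ C) {p q : X → ℝ} (hq : Measurable q) (hp1 : ∀ x, |p x| ≤ 1)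
    (hq1 : ∀ x, |q x| ≤ 1) (x : X) : Integrable (fun y => p x * Kr x y * q y) μ := by
  refine Integrable.of_bound
    ((measurable_const.mul (hK.of_uncurry_left (x := x)).measurable).mul hq).aestronglyMeasurable (max C 0)
    (Eventually.of_forall fun y => ?_)
  rw [norm_mul, norm_mul, Real.norm_eq_abs, Real.norm_eq_abs (q y)]
  calc |p x| * ‖Kr x y‖ * |q y| ≤ 1 * max C 0 * 1 :=
        mul_le_mul (mul_le_mul (hp1 x) ((hC x y).trans (le_max_left _ _)) (norm_nonneg _) zero_le_one)
          (hq1 y) (abs_nonneg _) (by positivity)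
    _ = max C 0 := by ring

/-- … and so are their integrals as functions of the outer variable. -/
theorem integrable_integral_realSection {Kr : X → X → ℝ} {C : ℝ} (hK : StronglyMeasurable (uncurry Kr))
    (hC : ∀ x y, ‖Kr x y‖ ≤ C) {p q : X → ℝ} (hp : Measurable p) (hq : Measurable q) (hp1 : ∀ x, |p x| ≤ 1)
    (hq1 : ∀ x, |q x| ≤ 1) : Integrable (fun x => ∫ y, p x * Kr x y * q y ∂μ) μ := by
  have hG : StronglyMeasurable fun x => ∫ y, Kr x y * q y ∂μ := by
    have h2 : StronglyMeasurable fun z : X × X => uncurry Kr z * q z.2 :=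
      hK.mul (hq.comp measurable_snd).stronglyMeasurable
    simpa [uncurry] using h2.integral_prod_right'
  have heq : (fun x => ∫ y, p x * Kr x y * q y ∂μ) = fun x => p x * ∫ y, Kr x y * q y ∂μ := by
    funext x; simp_rw [mul_assoc]; exact integral_const_mul _ _
  rw [heq]
  refine Integrable.of_bound (hp.stronglyMeasurable.mul hG).aestronglyMeasurable (1 * (max C 0 * μ.real Set.univ))
    (Eventually.of_forall fun x => ?_)
  rw [norm_mul, Real.norm_eq_abs]
  refine mul_le_mul (hp1 x) (norm_integral_le_of_norm_le_const (Eventually.of_forall fun y => ?_))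
    (norm_nonneg _) zero_le_one
  rw [norm_mul, Real.norm_eq_abs (q y)]
  calc ‖Kr x y‖ * |q y| ≤ max C 0 * 1 :=
        mul_le_mul ((hC x y).trans (le_max_left _ _)) (hq1 y) (abs_nonneg _) (by positivity)
    _ = max C 0 := mul_one _

/-- **Real positive type implies complex positive type** for a real kernel: `Re ∬ conj f · K · f = ∬ uKu + ∬ vKv`
with `u = Re f`, `v = Im f`. -/
theorem complexPosType_of_real {Kr : X → X → ℝ} {C : ℝ} (hK : StronglyMeasurable (uncurry Kr))
    (hC : ∀ x y, ‖Kr x y‖ ≤ C)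
    (hreal : ∀ φ : X → ℝ, Measurable φ → (∀ x, |φ x| ≤ 1) → 0 ≤ ∫ x, ∫ y, φ x * Kr x y * φ y ∂μ ∂μ)
    (f : X → ℂ) (hf : Measurable f) (hf1 : ∀ x, ‖f x‖ ≤ 1) :
    0 ≤ (∫ x, ∫ y, conj (f x) * ((Kr x y : ℝ) : ℂ) * f y ∂μ ∂μ).re := by
  set u : X → ℝ := fun x => (f x).re with hu_def
  set v : X → ℝ := fun x => (f x).im with hv_def
  have hu : Measurable u := Complex.measurable_re.comp hf
  have hv : Measurable v := Complex.measurable_im.comp hf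
  have hu1 : ∀ x, |u x| ≤ 1 := fun x => (Complex.abs_re_le_norm _).trans (hf1 x)
  have hv1 : ∀ x, |v x| ≤ 1 := fun x => (Complex.abs_im_le_norm _).trans (hf1 x)
  -- pointwise decomposition of the integrand
  have hpt : ∀ x y, conj (f x) * ((Kr x y : ℝ) : ℂ) * f y =
      (((u x * Kr x y * u y + v x * Kr x y * v y : ℝ) : ℂ)) +
        Complex.I * (((u x * Kr x y * v y - v x * Kr x y * u y : ℝ) : ℂ)) := by
    intro x y
    (apply Complex.ext <;> simp [hu_def, hv_def, Complex.mul_re, Complex.mul_im]); ring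
  -- inner integrals
  have hin : ∀ x, (∫ y, conj (f x) * ((Kr x y : ℝ) : ℂ) * f y ∂μ) =
      (((∫ y, u x * Kr x y * u y ∂μ) + (∫ y, v x * Kr x y * v y ∂μ) : ℝ) : ℂ) +
        Complex.I * (((∫ y, u x * Kr x y * v y ∂μ) - (∫ y, v x * Kr x y * u y ∂μ) : ℝ) : ℂ) := by
    intro x
    have i1 := integrable_realSection (μ := μ) hK hC (p := u) hu hu1 hu1 x
    have i2 := integrable_realSection (μ := μ) hK hC (p := v) hv hv1 hv1 x
    have i3 := integrable_realSection (μ := μ) hK hC (p := u) hv hu1 hv1 x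
    have i4 := integrable_realSection (μ := μ) hK hC (p := v) hu hv1 hu1 x
    simp_rw [hpt x]
    rw [integral_add (i1.add i2).ofReal ((i3.sub i4).ofReal.const_mul _), integral_const_mul,
      integral_complex_ofReal, integral_complex_ofReal, integral_add i1 i2, integral_sub i3 i4]
  -- outer integral
  have o1 := integrable_integral_realSection (μ := μ) hK hC hu hu hu1 hu1
  have o2 := integrable_integral_realSection (μ := μ) hK hC hv hv hv1 hv1
  have o3 := integrable_integral_realSection (μ := μ) hK hC hu hv hu1 hv1
  have o4 := integrable_integral_realSection (μ := μ) hK hC hv hu hv1 hu1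
  simp_rw [hin]
  rw [integral_add (o1.add o2).ofReal ((o3.sub o4).ofReal.const_mul _), integral_const_mul,
    integral_complex_ofReal, integral_complex_ofReal, integral_add o1 o2]
  simp only [Complex.add_re, Complex.ofReal_re, Complex.mul_re, Complex.I_re, Complex.I_im, Complex.ofReal_im,
    zero_mul, one_mul, sub_zero, add_zero]
  exact add_nonneg (hreal u hu hu1) (hreal v hv hv1)

end PositiveType

section Clauses

/-- Cast of the iterated REAL transfer operator: `κ_ℂ^{j}[h_ℂ] = (κ^{j}[h])_ℂ` pointwise. -/
theorem iterate_kernel_ofReal (K : X → X → ℝ) (h : X → ℝ) (j : ℕ) (y : X) :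
    ((fun f : X → ℂ => fun u => ∫ z, ((K u z : ℝ) : ℂ) * f z ∂μ)^[j] (fun z => ((h z : ℝ) : ℂ))) y =
      ((((fun f : X → ℝ => fun u => ∫ z, K u z * f z ∂μ)^[j] h) y : ℝ) : ℂ) := by
  induction j generalizing y with
  | zero => rfl
  | succ j ih =>
    rw [Function.iterate_succ_apply', Function.iterate_succ_apply']
    simp_rw [ih]
    rw [← integral_complex_ofReal]
    push_cast
    rfl

variable [IsProbabilityMeasure μ] {Γ : Type*} {T : Γ → X → X}
  (hTm : ∀ c, MeasurePreserving (T c) μ μ) {K : X → X → ℝ} {C : ℝ} {A : Lp ℂ 2 μ →L[ℂ] Lp ℂ 2 μ}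
  {ι : Type*} [Countable ι] {b : HilbertBasis ι ℂ (Lp ℂ 2 μ)} {lam : ι → ℝ} {χ : ι → Γ → ℂ}

/-- **Z-clause in cast form**: `Σᵢ χᵢ(e) λᵢ^{M+2} = (∫ (κ^{M+1} K(·, x))(T_e x) dμ(x))_ℂ` (the twisted trace formula of §4
for the complexified real kernel, with the iterate cast back to `ℝ`). -/
theorem hasSum_chi_pow_ofReal_iterate (hK : StronglyMeasurable (uncurry K)) (hC : ∀ x y, ‖K x y‖ ≤ C)
    (hsymm : ∀ x y, K x y = K y x)
    (hA : ∀ φ : Lp ℂ 2 μ, (A φ : X → ℂ) =ᵐ[μ] fun x => ∫ y, ((K x y : ℝ) : ℂ) * φ y ∂μ)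
    (hb : ∀ i, A (b i) = (lam i : ℂ) • b i)
    (hχ : ∀ i c, lam i ≠ 0 → koop (T c) (hTm c) (b i) = χ i c • b i) (e : Γ) (M : ℕ) :
    HasSum (fun i => χ i e * (lam i : ℂ) ^ (M + 2))
      (((∫ x, ((fun f : X → ℝ => fun u => ∫ z, K u z * f z ∂μ)^[M + 1] (fun z => K z x)) (T e x) ∂μ : ℝ) : ℂ)) := by
  have hKc : StronglyMeasurable (uncurry fun x y => ((K x y : ℝ) : ℂ)) :=
    Complex.continuous_ofReal.comp_stronglyMeasurable hK
  have hCc : ∀ x y, ‖((K x y : ℝ) : ℂ)‖ ≤ C := fun x y => by rw [Complex.norm_real]; exact hC x y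
  have hherm : ∀ x y, ((K x y : ℝ) : ℂ) = conj ((K y x : ℝ) : ℂ) := fun x y => by
    rw [Complex.conj_ofReal, hsymm]
  have h := hasSum_chi_pow_integral_iterate_twisted hKc hCc hherm hA hb (hTm e) (χ := fun i => χ i e)
    (fun i hi => hχ i e hi) M
  have hv : ∀ x, ((fun f : X → ℂ => fun u => ∫ z, ((K u z : ℝ) : ℂ) * f z ∂μ)^[M + 1]
      (fun z => ((K z x : ℝ) : ℂ))) (T e x) =
      ((((fun f : X → ℝ => fun u => ∫ z, K u z * f z ∂μ)^[M + 1] (fun z => K z x)) (T e x) : ℝ) : ℂ) := fun x =>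
    iterate_kernel_ofReal K (fun z => K z x) (M + 1) (T e x)
  rw [← integral_complex_ofReal]
  simp_rw [← hv]
  exact h

/-- **W-clause in cast form.**  For a real block kernel `B_k` (operator `B` on `L²(ℂ)`), every twist `e` and every `M`:
`Σᵢ χᵢ(e) λᵢ^{M+4} ⟪bᵢ, B bᵢ⟫ = (∫ k_e(V 0, V 1) ∏_{t<M+2} K(V (t+1), V (t+2)) dμ^{⊗(M+3)}(V))_ℂ` with the real kernel
`k_e(x, y) = ∫ K(x, u) ∫ B_k(u, v) K(T_e v, y) dμ(v) dμ(u)` of `𝔸 B U_e 𝔸` (the sandwiched trace formula of §0 for the insertion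
`B U_e`, kernels composed by §6, and `U_e bᵢ = χᵢ(e) bᵢ` wherever `λᵢ ≠ 0`). -/
theorem hasSum_chi_pow_inner_block (hK : StronglyMeasurable (uncurry K)) (hC : ∀ x y, ‖K x y‖ ≤ C)
    (hsymm : ∀ x y, K x y = K y x)
    (hA : ∀ φ : Lp ℂ 2 μ, (A φ : X → ℂ) =ᵐ[μ] fun x => ∫ y, ((K x y : ℝ) : ℂ) * φ y ∂μ)
    (hb : ∀ i, A (b i) = (lam i : ℂ) • b i)
    (hχ : ∀ i c, lam i ≠ 0 → koop (T c) (hTm c) (b i) = χ i c • b i)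
    {Bk : X → X → ℝ} {CB : ℝ} {B : Lp ℂ 2 μ →L[ℂ] Lp ℂ 2 μ} (hBk : StronglyMeasurable (uncurry Bk))
    (hCB : ∀ x y, ‖Bk x y‖ ≤ CB)
    (hB : ∀ φ : Lp ℂ 2 μ, (B φ : X → ℂ) =ᵐ[μ] fun x => ∫ y, ((Bk x y : ℝ) : ℂ) * φ y ∂μ) (e : Γ) (M : ℕ) :
    HasSum (fun i => χ i e * ((lam i ^ (M + 4) : ℝ) : ℂ) * ⟪(b i : Lp ℂ 2 μ), B (b i)⟫_ℂ)
      (((∫ V : Fin (M + 3) → X, (∫ u, K (V 0) u * ∫ v, Bk u v * K (T e v) (V 1) ∂μ ∂μ) *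
          ∏ t : Fin (M + 2), K (V t.succ) (V (t.succ + 1)) ∂(Measure.pi fun _ => μ) : ℝ) : ℂ)) := by
  -- complexified kernels
  set Kc : X → X → ℂ := fun x y => ((K x y : ℝ) : ℂ) with hKcdef
  set Bc : X → X → ℂ := fun x y => ((Bk x y : ℝ) : ℂ) with hBcdef
  have hKc : StronglyMeasurable (uncurry Kc) := Complex.continuous_ofReal.comp_stronglyMeasurable hK
  have hBc : StronglyMeasurable (uncurry Bc) := Complex.continuous_ofReal.comp_stronglyMeasurable hBk
  have hCc : ∀ x y, ‖Kc x y‖ ≤ C := fun x y => by rw [hKcdef, Complex.norm_real]; exact hC x y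
  have hCBc : ∀ x y, ‖Bc x y‖ ≤ CB := fun x y => by rw [hBcdef, Complex.norm_real]; exact hCB x y
  have hherm : ∀ x y, Kc x y = conj (Kc y x) := fun x y => by rw [hKcdef, Complex.conj_ofReal, hsymm]
  -- the insertion `B U_e` and the kernel of `𝔸 (B U_e) 𝔸`
  set U := koop (T e) (hTm e) with hUdef
  have hUA : ∀ φ : Lp ℂ 2 μ, ((U.comp A) φ : X → ℂ) =ᵐ[μ] fun x => ∫ y, Kc (T e x) y * φ y ∂μ :=
    koop_comp_ae_kernel hA (hTm e)
  have hKU : StronglyMeasurable (uncurry fun x y => Kc (T e x) y) := stronglyMeasurable_twistKernel hKc (hTm e).measurable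
  have hCU : ∀ x y, ‖Kc (T e x) y‖ ≤ C := fun x y => hCc _ _
  set k₁ : X → X → ℂ := fun x y => ∫ v, Bc x v * Kc (T e v) y ∂μ with hk₁def
  have hBUA : ∀ φ : Lp ℂ 2 μ, ((B.comp (U.comp A)) φ : X → ℂ) =ᵐ[μ] fun x => ∫ y, k₁ x y * φ y ∂μ :=
    comp_ae_kernel hBc hKU hCBc hCU hB hUA
  have hk₁m : StronglyMeasurable (uncurry k₁) := stronglyMeasurable_compKernel hBc hKU
  have hk₁C : ∀ x y, ‖k₁ x y‖ ≤ CB * C * μ.real Set.univ := fun x y => norm_compKernel_le hCBc hCU x y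
  set kB : X → X → ℂ := fun x y => ∫ u, Kc x u * k₁ u y ∂μ with hkBdef
  have hABUA : ∀ φ : Lp ℂ 2 μ, ((A.comp (B.comp (U.comp A))) φ : X → ℂ) =ᵐ[μ] fun x => ∫ y, kB x y * φ y ∂μ :=
    comp_ae_kernel hKc hk₁m hCc hk₁C hA hBUA
  have hkBm : StronglyMeasurable (uncurry kB) := stronglyMeasurable_compKernel hKc hk₁m
  have hkBC : ∀ x y, ‖kB x y‖ ≤ C * (CB * C * μ.real Set.univ) * μ.real Set.univ := fun x y =>
    norm_compKernel_le hCc hk₁C x y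
  -- the sandwiched trace formula for the insertion `B U_e`
  have hS := SandwichCopy.hasSum_pow_inner_sandwich_rclike (𝕜 := ℂ) hKc hCc hherm hA hb (B := B.comp U) hkBm hkBC
    (by simpa only [ContinuousLinearMap.comp_assoc] using hABUA) M
  -- identify the value
  have hval : (∫ V : Fin (M + 3) → X, kB (V 0) (V 1) * ∏ t : Fin (M + 2), Kc (V t.succ) (V (t.succ + 1))
      ∂(Measure.pi fun _ => μ)) =
      (((∫ V : Fin (M + 3) → X, (∫ u, K (V 0) u * ∫ v, Bk u v * K (T e v) (V 1) ∂μ ∂μ) *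
          ∏ t : Fin (M + 2), K (V t.succ) (V (t.succ + 1)) ∂(Measure.pi fun _ => μ) : ℝ) : ℂ)) := by
    rw [← integral_complex_ofReal]
    refine integral_congr_ae (Eventually.of_forall fun V => ?_)
    dsimp only
    have hk : kB (V 0) (V 1) = ((∫ u, K (V 0) u * ∫ v, Bk u v * K (T e v) (V 1) ∂μ ∂μ : ℝ) : ℂ) := by
      rw [hkBdef, ← integral_complex_ofReal]
      refine integral_congr_ae (Eventually.of_forall fun u => ?_)
      dsimp only
      rw [hk₁def]
      dsimp only
      rw [Complex.ofReal_mul, ← integral_complex_ofReal]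
      congr 1
      refine integral_congr_ae (Eventually.of_forall fun v => ?_)
      dsimp only
      rw [hBcdef, hKcdef]
      push_cast
      rfl
    rw [hk]
    push_cast
    rfl
  rw [← hval]
  -- identify the terms
  refine hS.congr_fun fun i => ?_
  by_cases hi : lam i = 0
  · rw [hi]
    push_cast
    simp
  · rw [ContinuousLinearMap.comp_apply, hUdef, hχ i e hi, map_smul, inner_smul_right]
    push_cast
    simp only [RCLike.ofReal_eq_complex_ofReal]
    ring

end Clauses

/-! ## §8  The located lattice stub `SliceRealisationV` and the kernel-checked derivation of D (`SpectralDictV`) -/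

section Lattice

open Literature.MathematicalPhysics.QuantumFieldTheory Literature.MathematicalPhysics.QuantumLattice
open Summit.QuantumFields.YangMills.Theorems.NonSimplyConnectedLatticeGap
open Summit.QuantumFields.YangMills.Cruxes.IRcof.EquipartitionSeam.KernelCurrency

/-- **L `SliceRealisationV` — TIME-SLICE REALISATION of the split-weight sector functions** (the located, purely
lattice-side stub that REPLACES D for provers: REAL kernels, Haar/Fubini identities, no spectral theory).
For every admissible split weight `w` (beyond thresholds `β_D`, `S_D β` chosen with species thickness `thick ≥ 1` and size
`nrm ≥ 0`) and every sector base `z₀` on the box `(2S+1)⁴` there is a probability space `(X, μ)` (intended: the spatial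
links of ONE time slice, `((Fin (2S+1))³ × Fin 3 → H)` with product Haar; `CountablyGenerated` from the faithful `ρH`,
cf. `BalabanBlockAverage` l.720), a bounded strongly measurable SYMMETRIC real kernel `K` of POSITIVE TYPE (intended: the
gauge-averaged slice-to-slice transfer kernel of the `w`-theory with the MAGNETIC part of `z₀` in the spatial plaquette
weights — `K(V,V') = ∫ ∏_links w(V_l⁻¹ g_p V'_l g_{p+î}⁻¹) dg · (spatial weights)`, positive because `w` is a positive-type
class function (`TwistSplitWeight` clause 5) and gauge averaging is a projection commuting with the ungauged kernel;
Osterwalder–Seiler 1978, Seiler LNP 159 Ch. 2), a measure-preserving ACTION `T` of the electric twist group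
`(Fin 3 → ker π)` leaving `K` invariant (intended: multiplication of the direction-`i` links on the stack `{x_i = 0}` by the
central element `e_i`), such that
(Z) `Z_w(z₀|e; (M+2) × (2S+1)³) = ∫ (κ^{M+1} K(·, x))(T_e x) dμ(x)` — the electric twist is the seam operator `U_e` in
`tr U_e 𝔸^{M+2}` (move the Dirac sheet to one seam; `κ f = ∫ K(·,y) f(y) dμ(y)`), and
(W) for every species `A` with `4·thick A ≤ 2S+1`: a real block kernel `B_k` spanning `thick A = r_B + 1` steps, dominated
POINTWISE by `nrm A · P_{r_B}` (`pathK`, the `(r_B+1)`-step path kernel of `K`; `|A.F| ≤ nrm A` and `w ≥ 0`), independent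
of `e` (species are functions of `π ∘ U`, blind to central multiplication, so the sheet can be moved off the block), with
`W_{w,A}(z₀|e) = ∫ k_e(V 0, V 1) ∏_{t<M+2} K(V (t+1), V (t+2)) dμ^{⊗(M+3)}`, `k_e(x,y) = ∫ K(x,u) ∫ B_k(u,v) K(T_e v, y)`,
whenever `M + 4 + thick A = 2S+1` (cyclicity of the torus trace).
Why it might fail AS TYPED: only by a convention slip (orientation of `T_e` vs `withEl`, `Fin.succ` bond indexing, the
`finTorusConfigEquivSite` reindexing in `secW`) — each repairable by re-indexing inside the proof; the mathematics is the
classical transfer-matrix slicing [Osterwalder–Seiler 1978; Seiler 1982 LNP 159; Simon, Lattice Gases I §II.4].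
The positive-type clause is stated in the tree's REAL form (`0 ≤ ∬ φ K φ` for measurable `|φ| ≤ 1`, exactly the conclusion shape
of `WilsonTorusTransferMatrix.integral_integral_fibreAverage_nonneg` — Lüscher's gauge-averaging argument, abstract — and of
`CentralFunctionTransferKernel.posType_kernel_zero`); the complex form needed by the spectral side is derived in §7
(`complexPosType_of_real`).  Templates in the tree: `SlabTransferKernel` (cyclic kernel chain
`∫ Ψ e^{−S} = ∫ Ψ(V) ∏_t sliceKernel(V t, V (t+1)) dV`, Wilson weights), `WilsonFinTorusSliceKernel` ∕ `…SliceChain` ∕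
`…MagneticSliceKernel` ∕ `…SliceObservables` (assemble ∕ reindexing lemmas, time = last axis there — permute axes),
`TwistedKernelTraceFormula.integral_cyclic_twisted_eq_integral_iterate`, `HeterogeneousCyclicPeeling` (block contraction),
`PathKernelDomination`. -/
def SliceRealisationV : Prop :=
  ∀ (G : Type) [Group G] [TopologicalSpace G] [IsTopologicalGroup G] [CompactSpace G] [MeasurableSpace G]
    [BorelSpace G], IsCompactSimpleLieGroup G → ∀ (H : Type) [Group H] [TopologicalSpace H] [IsTopologicalGroup H]
    [CompactSpace H] [MeasurableSpace H] [BorelSpace H], IsCompactSimpleLieGroup H → SimplyConnectedSpace H →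
    ∀ (π : H →* G), Continuous π → Function.Surjective π → π.ker ≤ Subgroup.center H → (π.ker : Set H).Finite →
    π.ker ≠ ⊥ → ∀ (ρH : LatticeRep H) (r : LatticeRep G) (c : ℝ → ℝ), Tendsto (fun β => c β * β) atTop atTop →
      ∃ (thick : YMSpecies G → ℕ) (nrm : YMSpecies G → ℝ) (β_D : ℝ) (S_D : ℝ → ℕ),
        (∀ A : YMSpecies G, 1 ≤ thick A ∧ 0 ≤ nrm A) ∧
        ∀ β : ℝ, β_D ≤ β → ∀ w : H → ℝ, TwistSplitWeight π ρH r (c β) β w → ∀ S : ℕ, S_D β ≤ S →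
          ∀ z₀ : Sector π,
            ∃ (X : Type) (_ : MeasurableSpace X) (μ : Measure X) (K : X → X → ℝ) (C : ℝ)
              (T : (Fin 3 → ↥π.ker) → X → X),
              IsProbabilityMeasure μ ∧ MeasurableSpace.CountablyGenerated X ∧
              StronglyMeasurable (uncurry K) ∧ (∀ x y, ‖K x y‖ ≤ C) ∧ (∀ x y, K x y = K y x) ∧
              (∀ φ : X → ℝ, Measurable φ → (∀ x, |φ x| ≤ 1) → 0 ≤ ∫ x, ∫ y, φ x * K x y * φ y ∂μ ∂μ) ∧
              (∀ e, MeasurePreserving (T e) μ μ) ∧ T 1 = id ∧ (∀ a b, T (a * b) = T a ∘ T b) ∧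
              (∀ e x y, K (T e x) (T e y) = K x y) ∧
              (∀ (e : Fin 3 → ↥π.ker) (M : ℕ),
                secZ π w (withEl π z₀ e) S (M + 2) =
                  ∫ x, ((fun f : X → ℝ => fun u => ∫ y, K u y * f y ∂μ)^[M + 1] (fun y => K y x)) (T e x) ∂μ) ∧
              (∀ A : YMSpecies G, 4 * thick A ≤ 2 * S + 1 →
                ∃ (rB : ℕ) (Bk : X → X → ℝ) (CB : ℝ), rB + 1 = thick A ∧ StronglyMeasurable (uncurry Bk) ∧
                  (∀ x y, ‖Bk x y‖ ≤ CB) ∧ (∀ x y, |Bk x y| ≤ nrm A * pathK μ K rB x y) ∧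
                  ∀ (e : Fin 3 → ↥π.ker) (M : ℕ), M + 4 + thick A = 2 * S + 1 →
                    secW π w (withEl π z₀ e) S A =
                      ∫ V : Fin (M + 3) → X, (∫ u, K (V 0) u * ∫ v, Bk u v * K (T e v) (V 1) ∂μ ∂μ) *
                        ∏ t : Fin (M + 2), K (V t.succ) (V (t.succ + 1)) ∂(Measure.pi fun _ => μ))

/-- **D from L: the spectral dictionary `SpectralDictV` (stub D of skeleton rev 8, VERBATIM text of `KernelDefs`) follows from
the slice realisation** — joint eigenbasis of the complexified transfer operator and the commuting unitary twists (§3),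
twisted trace formula (§4/§7), growth rate `= ‖𝔸‖` (§5), block coefficients bounded by path-kernel domination (§6) and the
sandwiched trace formula (§0/§7).  Sorry-free. -/
theorem spectralDictV_of_sliceRealisationV (hL : SliceRealisationV) : SpectralDictV := by
  intro G _ _ _ _ _ _ hG H _ _ _ _ _ _ hH hsc π hπc hπs hker hfin hne ρH r c hc
  obtain ⟨thick, nrm, β_D, S_D, hthick, hmain⟩ := hL G hG H hH hsc π hπc hπs hker hfin hne ρH r c hc
  refine ⟨thick, nrm, β_D, S_D, fun β hβ w hw S hS z₀ => ?_⟩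
  obtain ⟨X, mX, μ, K, C, T, hprob, hcg, hK, hC, hsymm, hpt, hTm, hT1, hTmul, hKT, hZ, hW⟩ :=
    hmain β hβ w hw S hS z₀
  classical
  -- a nonnegative bound
  have hC' : ∀ x y, ‖K x y‖ ≤ max C 0 := fun x y => (hC x y).trans (le_max_left _ _)
  -- the complexified kernel and its operator `𝔸`
  set Kc : X → X → ℂ := fun x y => ((K x y : ℝ) : ℂ) with hKcdef
  have hKc : StronglyMeasurable (uncurry Kc) := Complex.continuous_ofReal.comp_stronglyMeasurable hK
  have hCc : ∀ x y, ‖Kc x y‖ ≤ max C 0 := fun x y => by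
    simp only [hKcdef, Complex.norm_real]; exact hC' x y
  have hherm : ∀ x y, Kc x y = conj (Kc y x) := fun x y => by simp only [hKcdef, Complex.conj_ofReal, hsymm]
  obtain ⟨A, hA⟩ := exists_kernelOp_rclike (𝕜 := ℂ) (μ := μ) hKc hCc
  have hAsa : IsSelfAdjoint A := isSelfAdjoint_of_ae_hermitianKernel hKc hCc hherm hA
  have hAc : IsCompactOperator A := isCompactOperator_of_ae_kernel hCc (le_max_right _ _) hA
  have hpos : ∀ φ : Lp ℂ 2 μ, 0 ≤ (⟪φ, A φ⟫_ℂ).re :=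
    re_inner_kernelOp_self_nonneg hA (complexPosType_of_real hK hC hpt)
  have hAU : ∀ e, A * koop (T e) (hTm e) = koop (T e) (hTm e) * A :=
    kernelOp_mul_koop hTm hKc hA (fun e x y => by simp only [hKcdef, hKT])
  have hcomm : ∀ a b : Fin 3 → ↥π.ker, a * b = b * a := fun a b => funext fun i => Subtype.ext (by
    simp only [Pi.mul_apply, Subgroup.coe_mul]
    exact (Subgroup.mem_center_iff.mp (hker (a i).2) (b i)).symm)
  obtain ⟨s, b, lam, χ, hcoe, hb, hlam, hχmul, hχnorm, hχ, -⟩ :=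
    exists_jointEigenbasis hTm hT1 hTmul hcomm hAsa hAc hAU hpos
  -- countability of the basis (separability of `L²` of a countably generated probability space)
  haveI : Fact ((2 : ℝ≥0∞) ≠ ∞) := ⟨ENNReal.ofNat_ne_top⟩
  haveI : MeasurableSpace.CountablyGenerated X := hcg
  have hsc' : s.Countable := by
    have hon : Orthonormal ℂ ((↑) : s → Lp ℂ 2 μ) := by
      have h : ((↑) : s → Lp ℂ 2 μ) = ⇑b := funext fun i => (hcoe i).symm
      rw [h]; exact b.orthonormal
    exact hon.countable_of_separableSpace
  haveI : Countable s := hsc'.to_subtype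
  -- (Z) in cast form, for every twist and every time extent ≥ 2
  have hZc : ∀ (e : Fin 3 → ↥π.ker) (M : ℕ),
      HasSum (fun i : s => χ i e * (lam i : ℂ) ^ (M + 2)) ((secZ π w (withEl π z₀ e) S (M + 2) : ℝ) : ℂ) := by
    intro e M
    rw [hZ e M]
    exact hasSum_chi_pow_ofReal_iterate hTm hK hC hsymm hA hb hχ e M
  -- the trivial twist has trivial characters
  have hχ1 : ∀ i : s, χ i 1 = 1 := fun i => by
    have hne : χ i 1 ≠ 0 := fun h0 => by
      have h := hχnorm i 1; rw [h0, norm_zero] at h; exact zero_ne_one h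
    have h1 : χ i 1 * χ i 1 = χ i 1 * 1 := by rw [mul_one, ← hχmul, mul_one]
    exact mul_left_cancel₀ hne h1
  -- growth rate `= ‖𝔸‖`
  have hgrowth : growthRate π w z₀ S = ‖A‖ := by
    refine limsup_rpow_eq_norm b hAsa hAc (fun φ => by simpa using hpos φ) hb (fun i => (hlam i).1)
      (Z := fun m => secZ π w (elOff π z₀) S (m + 1)) fun n => ?_
    have h := hZc 1 n
    simp_rw [hχ1, one_mul] at h
    have h' : HasSum (fun i : s => ((lam i ^ (n + 2) : ℝ) : ℂ)) ((secZ π w (withEl π z₀ 1) S (n + 2) : ℝ) : ℂ) := by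
      simpa only [Complex.ofReal_pow] using h
    exact Complex.hasSum_ofReal.mp h'
  -- the package
  refine ⟨s, lam, χ, fun i => ⟨(hlam i).1, hgrowth ▸ (hlam i).2⟩, hχmul, hχnorm, fun m hm e => ?_, fun A' hA' => ?_⟩
  · obtain ⟨M, rfl⟩ : ∃ M, m = M + 2 := ⟨m - 2, by omega⟩
    simpa only [Complex.ofReal_pow] using hZc e M
  · obtain ⟨rB, Bk, CB, hrB, hBk, hCB, hdom, hWid⟩ := hW A' hA'
    set Bc : X → X → ℂ := fun x y => ((Bk x y : ℝ) : ℂ) with hBcdef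
    have hBc : StronglyMeasurable (uncurry Bc) := Complex.continuous_ofReal.comp_stronglyMeasurable hBk
    have hCBc : ∀ x y, ‖Bc x y‖ ≤ CB := fun x y => by simp only [hBcdef, Complex.norm_real]; exact hCB x y
    obtain ⟨B, hB⟩ := exists_kernelOp_rclike (𝕜 := ℂ) (μ := μ) hBc hCBc
    refine ⟨fun i => ⟪(b i : Lp ℂ 2 μ), B (b i)⟫_ℂ, (hthick A').2, fun i => ?_, fun e => ?_⟩
    · have h := norm_inner_le_of_abs_le_pathK hK hC hA hBk hCB hB (hthick A').2 hdom (b i)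
      rw [b.orthonormal.1 i, one_pow, mul_one, hrB, ← hgrowth] at h
      exact h
    · obtain ⟨M, hM⟩ : ∃ M, M + 4 + thick A' = 2 * S + 1 := ⟨2 * S + 1 - thick A' - 4, by
        have h1 := (hthick A').1; omega⟩
      have h := hasSum_chi_pow_inner_block hTm hK hC hsymm hA hb hχ hBk hCB hB e M
      rw [← hWid e M hM] at h
      have hexp : 2 * S + 1 - thick A' = M + 4 := by omega
      rw [hexp]
      exact h

end Lattice
end Summit.QuantumFields.YangMills.Cruxes.IRcof.EquipartitionSeam.SpectralDict

end
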